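import Literature.NumberTheory.EllipticCurves.MultiplicativeUnipotentTorsionProofs
import Literature.NumberTheory.EllipticCurves.KernelReductionInertiaProofs
import Literature.NumberTheory.EllipticCurves.MazurTorsionGaloisStructureProofs
import Literature.NumberTheory.EllipticCurves.IsogenyDualInseparableProofs
import Literature.NumberTheory.EllipticCurves.GeomPointReduction
import Literature.NumberTheory.EllipticCurves.TamagawaSubgroupProofs
import Literature.NumberTheory.EllipticCurves.HeegnerPointsKolyvaginLocalCriterion
import Literature.NumberTheory.EllipticCurves.TamagawaRingEquivProofs
import Literature.NumberTheory.EllipticCurves.MazurTorsionStepTwoAtNProofs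
import Literature.NumberTheory.EllipticCurves.MazurTorsionStepFourProofs
import Literature.NumberTheory.EllipticCurves.KernelReductionOrdinaryTorsionProofs
import Literature.NumberTheory.EllipticCurves.DivisionPolynomialTorsion
import Literature.NumberTheory.EllipticCurves.TorsionCardinality
import Literature.NumberTheory.EllipticCurves.TamagawaPrimesEquivProofs
import Literature.NumberTheory.EllipticCurves.LFunctionPrimeCoeff
import Literature.RingTheory.DiscreteValuationRing.AdicCompletionResidueField
import Mathlib.Algebra.CubicDiscriminant
import HarnessLib

/-!
# Mazur 1977, Ch. III §5, Step 4 at the prime `N` itself: a decomposition group above `N` acts on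
# `E[N]` through `μ_N` ("`E[N]_{/ℤ_N} ≅ ℤ/N × μ_N`" without finite flat group schemes or Tate curves)

Sibling proof file (theorems only, no definitions, no named facts) of `MazurTorsionStepFourProofs`
(Step 4 at the primes `q ≠ N`), for the prime-case leaf
`Literature.NumberTheory.EllipticCurves.Mazur1977_no_prime_torsion W` (B. Mazur, *Modular curves
and the Eisenstein ideal*, Publ. Math. IHÉS 47 (1977), Ch. III §5, pp. 156–160).

Step 4 (p. 160) at the places of `K = ℚ(ζ_N)` above `N`, for the putative curve `E/ℚ` with a
rational point `P` of prime order `N`, reads: "(ii) `q = N`; `E` has good reduction at `N`: Again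
`E[N]_{/ℤ}` is a finite flat group scheme. Applying the 'connected component of the identity'
functor to (4.4) one sees that `(ℤ/N_{/ℤ_N})⁰ = 0` and therefore we get a splitting:
`E[N]_{/ℤ_N} = ℤ/N_{/ℤ_N} × μ_{N/ℤ_N}` which shows that `L/K` is unramified at all places of `K`
lying above `N`. (iii) `q` a rational prime of bad reduction for `E`: Since
`ℤ/N_{/𝔽_q} ⊄ (E_{/𝔽_q})⁰` by step 3, one obtains, as in (ii), `E[N]_{/ℤ_q} ≅ ℤ/N_{/ℤ_q} × μ_{N/ℤ_q}`
giving us the same conclusion".  We prove the Galois-theoretic content of both assertions at the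
place above `N` — *every element of a decomposition group above `N` which fixes the `N`-th roots of
unity fixes `E[N]` pointwise* (so the primes of `K` above `N` split completely in `L = K(E[N])`, in
particular are unramified) — by elementary means, over any number field `K` and place `v ∣ p`:

* `WeierstrassCurve.map_eq_of_forall_pow_eq_one_of_hasGoodReduction` — (ii): `X/K_v` minimal with
  good reduction, `P ∈ X(K_v)`, `P ≠ O`, `p P = O`, with `v`-integral abscissa; then every
  `τ ∈ Γ_{K_v}` fixing `μ_p(K̄_v)` fixes `X(K̄_v)[p]`.  Proof: `C = E[p] ∩ E₁` has `≥ p` elements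
  because the reduction `Ẽ/κ_w` has at most `p` points killed by `p`
  (`natCard_geomTorsion_expChar_le`, Silverman III.6.4(c)); `P ∉ C`; `τ S - χ̄_p(τ) S ∈ ⟨P⟩` for all
  `S ∈ E[p]` (Mazur's (5.4), `smul_sub_cyclotomic_smul_mem_zmultiples`, from `det ρ̄ = χ̄` and the
  Weil pairing); `⟨P⟩ ∩ E₁ = 0`; so `τ` with `χ̄_p(τ) = 1` fixes `C` and `P`, which generate `E[p]`.
* `WeierstrassCurve.hasseCoeff_ne_zero_of_node` — the Hasse invariant of a nodal cubic over an
  algebraically closed field of odd characteristic `p` is non-zero (the cubic is `4(X - α)²(X - γ)`,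
  `α ≠ γ`, and the coefficient of `X^{p-1}` in its `(p-1)/2`-th power is `4^m (α - γ)^m`, by
  `(X - α)^{p-1} = ∑ X^i α^{p-1-i}` in characteristic `p`): "the multiplicative group is ordinary".
* `WeierstrassCurve.map_eq_of_forall_pow_eq_one_of_not_mem_goodReductionSubgroup` — (iii) at
  `v ∣ p` (`p` odd): `X/K_v` minimal with multiplicative reduction and `P ∈ X(K_v)`, `p P = O`, off
  `E₀(K_v)`; then every `τ ∈ Γ_{K_v}` fixing `μ_p(K̄_v)` fixes `X(K̄_v)[p]`.  Proof: the node is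
  ordinary, so `ΨSq_p` has a root of valuation `> 1`
  (`card_roots_ΨSq_prime_filter_one_lt_valuation`): a point `S₀ ≠ O` of order `p` in `E₁` (the
  Tate-curve `μ_p ⊂ E[p]`); `⟨P⟩ ∩ E₁ = 0` and (5.4) show that `τ` fixes `S₀` and `P`, which
  generate `E[p]`.
* Local and global forms for an elliptic curve `E/K`
  (`smul_localPoints_eq_…`, `smul_eq_of_forall_pow_eq_one_of_hasGoodReductionAt`,
  `smul_eq_of_forall_pow_eq_one_of_not_mem_goodReductionSubgroup`): for `𝔓 ∣ v` and `τ` in the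
  decomposition group `D_𝔓 ≤ Γ_K` fixing `μ_p(K̄)`, `τ` fixes `E[p]` (lift of `τ` to `Γ_{K_v}` by
  Neukirch II (9.6) for decomposition groups, tree
  `exists_apply_eq_smul_of_mem_decompositionSubgroup`).
* `not_mem_goodReductionSubgroup_of_hasMultiplicativeReduction_of_mem_adicCompletionIntegers` — at a
  multiplicative `v ∣ p` an integral `p`-torsion point `≠ O` is off `E₀` (`E₀/E₁ ↪ \bar κ^×` has no
  element of order `p`).
* Over `ℚ`: `mem_adicCompletionIntegers_of_prime_nsmul_eq_zero` (`E₁(ℚ_v)[p] = 0` for `p ≥ 3`,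
  transport of the tree's `not_prime_zsmul_eq_zero_of_one_lt_norm` along `ℚ_v ≃ ℚ_[p]`) and the
  assembly **`Mazur1977_smul_eq_of_forall_pow_eq_one_at_N`**: for `E/ℚ` with a rational point of
  prime order `N ∉ {2, 3, 5, 7, 13}`, every `τ ∈ D_𝔓` (`𝔓 ∣ N`) fixing `μ_N` fixes `E[N]` — via the
  tree's dichotomy `Mazur1977_at_N` (good, or split multiplicative) and the bridges
  `hasGoodReductionAtPrime_primesEquiv_iff_holds`, `hasMultiplicativeReductionAtPrime_primesEquiv_iff_holds`.

* **`Mazur1977_stepFour_of_stepThree`** — Step 4 at *every* finite place ("`L/K` is unramified"):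
  for every `v`, `𝔓 ∣ v` and `τ ∈ I_𝔓` fixing `μ_N`, `τ` fixes `E[N]`, from the conclusion of Step 3
  at the bad places `v ∤ N` (tree `Mazur1977_smul_eq_of_mem_inertia_of_stepThree` at `v ∤ N`, the
  at-`N` theorem above at `v ∣ N`); and the unconditional `Mazur1977_stepFour_of_lt_or_eq` at the
  places with `p_v + 1 < N` or `p_v = N`.

Together with `MazurTorsionStepFourProofs` this completes the formalisation of Mazur's Step 4 modulo
the conclusion of Step 3 at the bad primes `q ≥ N - 1`, `q ≠ N` (the modular input of the printed
proof).

## References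

* [Mazur1977] B. Mazur, *Modular curves and the Eisenstein ideal*, Publ. Math. IHÉS 47 (1977),
  Ch. III §5, (5.4) p. 157 and Step 4, p. 160.
* [SilvermanAEC2009] J. H. Silverman, *The Arithmetic of Elliptic Curves*, 2nd ed. (2009),
  III.6.4, III.8, V.4.1(a), VII.2.1, VII.3.1, IV.6.1, Exercise 3.7.
* [SilvermanATAEC1994] J. H. Silverman, *Advanced Topics in the Arithmetic of Elliptic Curves*
  (1994), V.4–V.5 (the Tate-curve form of (iii)).
* [NeukirchANT1999] J. Neukirch, *Algebraic Number Theory* (1999), Ch. II §9, Prop. (9.6).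

## Design

No definitions; `noncomputable section`; `open scoped Classical NNReal Pointwise`; one universe
`u`.  Setting and skeleton as in `MazurTorsionStepFourProofs` (explicit `𝒪_w`-model
`W₀ = X₀.map φ₀`); the hypothesis "`τ` fixes the `p`-th roots of unity" is spelled out
(`∀ ζ, ζ ^ p = 1 → τ • ζ = ζ`) rather than through a cyclotomic character, and is converted to
`χ̄_p(τ) = 1` for `Literature.NumberTheory.GaloisRepresentations.modPCyclotomicCharacterZMod` inside
the proofs.  `set_option maxHeartbeats` is raised for the two main proofs, as in the template.
-/

noncomputable section

open scoped Classical NNReal Pointwise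
open NumberField IsDedekindDomain

universe u

namespace WeierstrassCurve

/-! ## The Hasse invariant of a nodal cubic is non-zero -/

section HasseNode

open Polynomial

variable {k : Type*} [Field k]

/-- In characteristic `p`, `(X - α)^{p-1} = ∑_{i<p} X^i α^{p-1-i}` (from `(X - α)^p = X^p - α^p`
and the telescoping identity `(∑ X^i α^{p-1-i})(X - α) = X^p - α^p`). [folklore] -/
theorem X_sub_C_pow_sub_one_eq_sum {p : ℕ} [Fact p.Prime] [CharP k p] (α : k) :
    (X - C α : k[X]) ^ (p - 1) = ∑ i ∈ Finset.range p, X ^ i * C α ^ (p - 1 - i) := by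
  have hp : p.Prime := Fact.out
  have h1 : (∑ i ∈ Finset.range p, (X : k[X]) ^ i * C α ^ (p - 1 - i)) * (X - C α) =
      X ^ p - C α ^ p := geom_sum₂_mul X (C α) p
  have h2 : (X - C α : k[X]) ^ p = X ^ p - C α ^ p := sub_pow_char (X : k[X]) (C α)
  have h3 : (X - C α : k[X]) ^ (p - 1) * (X - C α) = X ^ p - C α ^ p := by
    rw [← pow_succ, Nat.sub_add_cancel hp.one_le, h2]
  exact mul_right_cancel₀ (X_sub_C_ne_zero α) (h3.trans h1.symm)

/-- For `H` of degree `< p`: the coefficient of `X^{p-1}` in `(∑_{i<p} X^i α^{p-1-i}) · H` is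
`H(α)`. [folklore] -/
theorem coeff_sum_mul_eq_eval {p : ℕ} (hp : 1 ≤ p) (α : k) (H : k[X]) (hH : H.natDegree < p) :
    ((∑ i ∈ Finset.range p, X ^ i * C α ^ (p - 1 - i)) * H).coeff (p - 1) = H.eval α := by
  have hG : ∀ n, (∑ i ∈ Finset.range p, (X : k[X]) ^ i * C α ^ (p - 1 - i)).coeff n =
      if n < p then α ^ (p - 1 - n) else 0 := by
    intro n
    rw [finsetSum_coeff]
    simp_rw [← C_pow, mul_comm (X ^ _ : k[X]) (C _), coeff_C_mul_X_pow]
    rw [Finset.sum_ite_eq (Finset.range p) n (fun i => α ^ (p - 1 - i))]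
    simp only [Finset.mem_range]
  rw [coeff_mul, Finset.Nat.sum_antidiagonal_eq_sum_range_succ (fun i j =>
    (∑ i ∈ Finset.range p, (X : k[X]) ^ i * C α ^ (p - 1 - i)).coeff i * H.coeff j),
    eval_eq_sum_range' hH, Nat.succ_eq_add_one, Nat.sub_add_cancel hp]
  rw [← Finset.sum_range_reflect]
  refine Finset.sum_congr rfl fun j hj => ?_
  rw [Finset.mem_range] at hj
  rw [hG]
  have hlt : p - 1 - j < p := by omega
  rw [if_pos hlt, show p - 1 - (p - 1 - j) = j by omega, mul_comm]

/-- The coefficient of `X^{p-1}` in `4^m (X - α)^{p-1} (X - γ)^m` is `4^m (α - γ)^m`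
(`m = (p-1)/2`, characteristic `p`). [folklore] -/
theorem coeff_node_pow {p : ℕ} [Fact p.Prime] [CharP k p] (hp2 : p ≠ 2) (α γ : k) :
    ((C (4 : k) * (X - C α) * (X - C α) * (X - C γ)) ^ ((p - 1) / 2)).coeff (p - 1) =
      4 ^ ((p - 1) / 2) * (α - γ) ^ ((p - 1) / 2) := by
  have hp : p.Prime := Fact.out
  obtain ⟨m, hm⟩ : ∃ m, p = 2 * m + 1 := hp.odd_of_ne_two hp2
  have hm' : (p - 1) / 2 = m := by omega
  rw [hm']
  have hexp : (C (4 : k) * (X - C α) * (X - C α) * (X - C γ)) ^ m =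
      C ((4 : k) ^ m) * ((X - C α) ^ (p - 1) * (X - C γ) ^ m) := by
    rw [show p - 1 = 2 * m by omega, C_pow, mul_pow, mul_pow, mul_pow]
    ring
  rw [hexp, coeff_C_mul, X_sub_C_pow_sub_one_eq_sum α,
    coeff_sum_mul_eq_eval hp.one_le α _ (by
      rw [natDegree_pow, natDegree_X_sub_C, mul_one]; omega)]
  rw [eval_pow, eval_sub, eval_X, eval_C]

/-- **The Hasse invariant of a nodal cubic is non-zero.**  Over an algebraically closed field of odd
characteristic `p`, a Weierstrass cubic with `Δ = 0` and `c₄ ≠ 0` (a node) has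
`A_p = coeff_{X^{p-1}} (4X³ + b₂X² + 2b₄X + b₆)^{(p-1)/2} ≠ 0`: the cubic is `4(X - α)²(X - γ)` with
`α ≠ γ` (`16Δ = disc`, `c₄ = 16(α - γ)²`), and the coefficient is `4^m (α - γ)^m`
(`(X - α)^{p-1} = ∑ X^i α^{p-1-i}` in characteristic `p`).  In the dictionary "node = 𝔾_m": the
multiplicative group is ordinary (cf. Silverman, *AEC* V.4.1(a) for the Hasse invariant as this
coefficient). [folklore] -/
theorem hasseCoeff_ne_zero_of_node [IsAlgClosed k] {p : ℕ} [Fact p.Prime] [CharP k p]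
    (hp2 : p ≠ 2) (V : WeierstrassCurve k) (hΔ : V.Δ = 0) (hc₄ : V.c₄ ≠ 0) :
    V.hasseCoeff p ≠ 0 := by
  have hp : p.Prime := Fact.out
  have h2 : (2 : k) ≠ 0 := fun h => by
    have := (CharP.cast_eq_zero_iff k p 2).mp (by exact_mod_cast h)
    exact hp2 ((Nat.prime_dvd_prime_iff_eq hp Nat.prime_two).mp this)
  have h4 : (4 : k) ≠ 0 := by
    have : (4 : k) = 2 * 2 := by norm_num
    rw [this]; exact mul_ne_zero h2 h2
  have ha : V.twoTorsionPolynomial.a ≠ 0 := h4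
  -- the cubic splits: roots `x, y, z`
  obtain ⟨x, y, z, h3⟩ := (Cubic.splits_iff_roots_eq_three ha (φ := RingHom.id k)).mp
    (IsAlgClosed.splits _)
  have hpoly : V.twoTorsionPolynomial.toPoly = C (4 : k) * (X - C x) * (X - C y) * (X - C z) := by
    have := Cubic.eq_prod_three_roots ha h3
    rwa [Cubic.map_toPoly, Polynomial.map_id] at this
  -- `disc = 0`: two roots coincide
  have hdisc : (4 : k) * 4 * (x - y) * (x - z) * (y - z) = 0 := by
    have h := Cubic.discr_eq_prod_three_roots ha h3
    rw [RingHom.id_apply, twoTorsionPolynomial_discr, hΔ, mul_zero] at h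
    exact pow_eq_zero_iff two_ne_zero |>.mp h.symm
  -- `c₄ = 16 ((x+y+z)² - 3(xy+xz+yz))`
  have hb := Cubic.b_eq_three_roots ha h3
  have hc := Cubic.c_eq_three_roots ha h3
  simp only [RingHom.id_apply] at hb hc
  change V.b₂ = 4 * -(x + y + z) at hb
  change 2 * V.b₄ = 4 * (x * y + x * z + y * z) at hc
  have hc₄' : V.c₄ = 16 * ((x + y + z) ^ 2 - 3 * (x * y + x * z + y * z)) := by
    rw [c₄, hb]
    linear_combination (-12 : k) * hc
  -- the coefficient, in the three cases
  rw [hasseCoeff, hpoly]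
  have h16 : (16 : k) ≠ 0 := by
    have : (16 : k) = 4 * 4 := by norm_num
    rw [this]; exact mul_ne_zero h4 h4
  have key : ∀ α γ : k, α ≠ γ →
      ((C (4 : k) * (X - C α) * (X - C α) * (X - C γ)) ^ ((p - 1) / 2)).coeff (p - 1) ≠ 0 := by
    intro α γ hαγ
    rw [coeff_node_pow hp2]
    exact mul_ne_zero (pow_ne_zero _ h4) (pow_ne_zero _ (sub_ne_zero.mpr hαγ))
  rcases mul_eq_zero.mp hdisc with h | h
  · rcases mul_eq_zero.mp h with h | h
    · rcases mul_eq_zero.mp h with h | h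
      · exact absurd h (mul_ne_zero h4 h4)
      · -- `x = y`
        have hxy : x = y := sub_eq_zero.mp h
        subst hxy
        have hxz : x ≠ z := by
          intro hxz; apply hc₄; rw [hc₄', hxz]; ring
        exact key x z hxz
    · -- `x = z`
      have hxz : x = z := sub_eq_zero.mp h
      subst hxz
      have hxy : x ≠ y := by
        intro hxy; apply hc₄; rw [hc₄', hxy]; ring
      rw [show C (4 : k) * (X - C x) * (X - C y) * (X - C x) =
        C (4 : k) * (X - C x) * (X - C x) * (X - C y) by ring]
      exact key x y hxy
  · -- `y = z`
    have hyz : y = z := sub_eq_zero.mp h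
    subst hyz
    have hxy : y ≠ x := by
      intro hxy; apply hc₄; rw [hc₄', hxy]; ring
    rw [show C (4 : k) * (X - C x) * (X - C y) * (X - C y) =
      C (4 : k) * (X - C y) * (X - C y) * (X - C x) by ring]
    exact key y x hxy

end HasseNode

open Literature.NumberTheory.EllipticCurves Literature.NumberTheory.GaloisRepresentations Field
  IsDedekindDomain.HeightOneSpectrum

variable {K : Type u} [Field K] [NumberField K] {v : HeightOneSpectrum (𝓞 K)}

set_option maxHeartbeats 4000000 in
/-- **At a place `v ∣ p` of good reduction, an integral `K_v`-rational point of order `p` makes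
`E[p] ≅ ℤ/p ⊕ μ_p` locally** (model form).  Let `X` be a minimal Weierstrass equation over `K_v`
of an elliptic curve with good reduction, `p` the residue characteristic of `v`, and `P ∈ X(K_v)`
a point `≠ O` with `p P = O` and `v`-integral abscissa (i.e. `P` does not reduce to `Õ`).  Then
every `τ ∈ Γ_{K_v}` fixing the `p`-th roots of unity of `K̄_v` fixes every `Q ∈ X(K̄_v)` with
`p Q = O`: the splitting field of `E[p]` over `K_v` is `K_v(ζ_p)`.  This is Mazur's Step 4 (ii)
(1977, III.§5, p. 160: "`q = N`; `E` has good reduction at `N`: … one sees that `(ℤ/N_{/ℤ_N})⁰ = 0`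
and therefore we get a splitting `E[N]_{/ℤ_N} = ℤ/N_{/ℤ_N} × μ_{N/ℤ_N}` which shows that `L/K` is
unramified at all places of `K` lying above `N`"), proved without finite flat group schemes:
with `C = E[p] ∩ E₁` (the `p`-torsion in the kernel of reduction for the spectral valuation),
`#C ≥ p` because the reduction `Ẽ/\bar κ` has at most `p` points of order dividing `p`
(`natCard_geomTorsion_expChar_le`, Silverman III.6.4(c)), `P ∉ C`, `τ S - χ̄_p(τ) S ∈ ⟨P⟩` for all
`S ∈ E[p]` (Mazur's (5.4), `smul_sub_cyclotomic_smul_mem_zmultiples`, from `det ρ̄ = χ̄` and the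
Weil pairing) and `⟨P⟩ ∩ C = 0`; so a `τ` with `χ̄_p(τ) = 1` fixes `C` and `P`, which generate
`E[p]`.
[cite: Mazur1977, Ch. III §5, Step 4 (ii), p. 160]
[cite: SilvermanAEC2009, VII.2.1, VII.3.1, Cor. III.6.4(b),(c), III.8] -/
theorem map_eq_of_forall_pow_eq_one_of_hasGoodReduction
    (X : WeierstrassCurve (v.adicCompletion K)) [X.IsElliptic]
    [hgood : X.HasGoodReduction (v.adicCompletionIntegers K)]
    {p : ℕ} (hp : p.Prime) (hpv : (p : 𝓞 K) ∈ v.asIdeal)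
    {P : X.toAffine.Point} (hpP : p • P = 0) (hP0 : P ≠ 0)
    (hPint : ∀ {x y : v.adicCompletion K} (h : X.toAffine.Nonsingular x y),
      P = .some x y h → x ∈ v.adicCompletionIntegers K)
    {τ : absoluteGaloisGroup (v.adicCompletion K)}
    (hτ : ∀ ζ : AlgebraicClosure (v.adicCompletion K), ζ ^ p = 1 → τ • ζ = ζ)
    (Q : (X.baseChange (AlgebraicClosure (v.adicCompletion K))).toAffine.Point) (hQ : p • Q = 0) :
    Affine.Point.map ((absoluteGaloisGroup.toAlgEquiv _ τ :
        AlgebraicClosure (v.adicCompletion K) ≃ₐ[v.adicCompletion K]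
          AlgebraicClosure (v.adicCompletion K)) :
        AlgebraicClosure (v.adicCompletion K) →ₐ[v.adicCompletion K]
          AlgebraicClosure (v.adicCompletion K)) Q = Q := by
  obtain ⟨w, hw⟩ := v.exists_spectralValuation
  have hv0 : w.Integers w.integer := Valuation.integer.integers w
  haveI : Fact p.Prime := ⟨hp⟩
  haveI : CharZero (v.adicCompletion K) :=
    charZero_of_injective_algebraMap (algebraMap K (v.adicCompletion K)).injective
  have hpF : (p : v.adicCompletion K) ≠ 0 := Nat.cast_ne_zero.mpr hp.ne_zero
  haveI : NeZero (p : v.adicCompletion K) := ⟨hpF⟩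
  have hpL : ((p : ℕ) : AlgebraicClosure (v.adicCompletion K)) ≠ 0 := fun h ↦ hpF
    ((algebraMap (v.adicCompletion K) (AlgebraicClosure (v.adicCompletion K))).injective
      (by rw [map_natCast, map_zero, h]))
  haveI : NeZero ((p : ℕ) : AlgebraicClosure (v.adicCompletion K)) := ⟨hpL⟩
  -- write `X = X₀ ⊗ K_v`
  obtain ⟨X₀, rfl⟩ : ∃ X₀ : WeierstrassCurve (v.adicCompletionIntegers K),
      X = X₀.baseChange (v.adicCompletion K) := IsIntegral.integral
  have hvR := integers_valuationRing_valuation (v.adicCompletionIntegers K) (v.adicCompletion K)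
  -- good reduction: `Δ ∉ 𝔪_v`
  have eΔ : (X₀.baseChange (v.adicCompletion K)).Δ =
      algebraMap (v.adicCompletionIntegers K) (v.adicCompletion K) X₀.Δ := map_Δ X₀ _
  have hΔu := hgood.goodReduction
  rw [eΔ, IsDedekindDomain.HeightOneSpectrum.valuation_eq_one_iff_notMem] at hΔu
  -- the ring homomorphism `𝓞_v → 𝒪_w` and the `𝒪_w`-model
  set f : v.adicCompletionIntegers K →+* AlgebraicClosure (v.adicCompletion K) :=
    (algebraMap (v.adicCompletion K) (AlgebraicClosure (v.adicCompletion K))).comp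
      (algebraMap (v.adicCompletionIntegers K) (v.adicCompletion K)) with hfdef
  have hfle : ∀ a, f a ∈ w.integer := fun a ↦
    (spectralValuation_algebraMap_le_one_iff hw _).mpr a.2
  set φ₀ : v.adicCompletionIntegers K →+* w.integer := f.codRestrict w.integer hfle with hφ₀def
  have hφ₀ : ∀ a, ((φ₀ a : w.integer) : AlgebraicClosure (v.adicCompletion K)) = f a := fun a ↦ rfl
  obtain ⟨𝔐, h𝔐⟩ := v.localPrimesAbove_nonempty
  haveI hφ₀loc : IsLocalHom φ₀ := ⟨fun a ha ↦ by
    by_contra hna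
    have hmem : a ∈ IsLocalRing.maximalIdeal (v.adicCompletionIntegers K) :=
      (IsLocalRing.mem_maximalIdeal _).mpr (mem_nonunits_iff.mpr hna)
    have hlt : w (f a) < 1 := spectralValuation_algebraMap_lt_one_of_mem_maximalIdeal hw h𝔐 hmem
    have h1 : w (f a) = 1 := by
      rw [← hφ₀]; exact (hv0.isUnit_iff_valuation_eq_one).mp ha
    exact absurd h1 hlt.ne⟩
  set W₀ : WeierstrassCurve w.integer := X₀.map φ₀ with hW₀def
  have hX : (X₀.baseChange (v.adicCompletion K)).baseChange (AlgebraicClosure (v.adicCompletion K)) =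
      W₀.baseChange (AlgebraicClosure (v.adicCompletion K)) := by
    rw [hW₀def]
    change (X₀.map _).map _ = (X₀.map φ₀).map (algebraMap w.integer _)
    rw [map_map, map_map]
    congr 1
  have hW₀Δ : IsUnit W₀.Δ := by
    rw [hW₀def, map_Δ, isUnit_map_iff]
    by_contra hnu
    exact hΔu ((IsLocalRing.mem_maximalIdeal _).mpr (mem_nonunits_iff.mpr hnu))
  set Ebar := W₀.map (IsLocalRing.residue w.integer) with hEbar
  haveI : Ebar.IsElliptic := isElliptic_map_residue hW₀Δ
  -- the residue field has characteristic `p`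
  have hpw : w (p : AlgebraicClosure (v.adicCompletion K)) < 1 := spectralValuation_natCast_lt_one hw hpv
  haveI : CharP (IsLocalRing.ResidueField w.integer) p :=
    charP_residueField_of_valuation_natCast_lt_one w hpw
  haveI : ExpChar (IsLocalRing.ResidueField w.integer) p := ExpChar.prime hp
  /- (1) the `p`-torsion `G` of `X(K̄_v)` (order `p²`) and its reduction `g : G → Ẽ(κ_w)` -/
  set G := torsionPoints (X₀.baseChange (v.adicCompletion K))
    (AlgebraicClosure (v.adicCompletion K)) p with hGdef
  have hcardG : Nat.card G = p ^ 2 :=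
    card_torsionPoints_eq_sq_holds (X₀.baseChange (v.adicCompletion K))
      (AlgebraicClosure (v.adicCompletion K)) hpL
  haveI hGfin : Finite G := Nat.finite_of_card_ne_zero (by rw [hcardG]; exact pow_ne_zero _ hp.ne_zero)
  have hmemG : ∀ R : ((X₀.baseChange (v.adicCompletion K)).baseChange
      (AlgebraicClosure (v.adicCompletion K))).toAffine.Point, R ∈ G ↔ p • R = 0 := fun R ↦ by
    rw [hGdef, mem_torsionPoints_iff, natCast_zsmul]
  set r := goodReductionHom W₀ hv0 hW₀Δ with hrdef
  set g : G →+ Ebar.toAffine.Point :=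
    r.comp ((Affine.Point.congrEquiv hX).toAddMonoidHom.comp G.subtype) with hgdef
  have hg : ∀ S : G, g S = r (Affine.Point.congrEquiv hX (S : ((X₀.baseChange
      (v.adicCompletion K)).baseChange (AlgebraicClosure (v.adicCompletion K))).toAffine.Point)) :=
    fun S ↦ rfl
  have hmemker : ∀ S : G, S ∈ g.ker ↔ W₀.ReducesToZero (Affine.Point.congrEquiv hX
      (S : ((X₀.baseChange (v.adicCompletion K)).baseChange
        (AlgebraicClosure (v.adicCompletion K))).toAffine.Point)) := fun S ↦ by
    rw [AddMonoidHom.mem_ker, hg, hrdef, goodReductionHom_eq_zero_iff hv0 hW₀Δ]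
  -- `#(range g) ≤ p`: it consists of `p`-torsion points of `Ẽ(κ_w) ↪ Ẽ(\bar κ_w)`
  have hrange : Nat.card g.range ≤ p := by
    set ιk := Affine.Point.map (W' := Ebar.toAffine) (S := IsLocalRing.ResidueField w.integer)
      (Algebra.ofId (IsLocalRing.ResidueField w.integer)
        (AlgebraicClosure (IsLocalRing.ResidueField w.integer))) with hιk
    have hinjι : Function.Injective ιk := Affine.Point.map_injective _
    haveI : Finite (geomTorsion Ebar (p : ℤ)) :=
      finite_torsionPoints_holds Ebar (AlgebraicClosure (IsLocalRing.ResidueField w.integer))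
        (by exact_mod_cast hp.ne_zero)
    have hmem : ∀ R : g.range, (ιk (R : Ebar.toAffine.Point) : geomPoints Ebar) ∈
        geomTorsion Ebar (p : ℤ) := by
      rintro ⟨R, S, rfl⟩
      refine (Submodule.mem_torsionBy_iff _ _).mpr ?_
      have e0 : p • S = 0 := Subtype.ext (by
        simp only [AddSubgroup.coe_nsmul, ZeroMemClass.coe_zero]
        exact (hmemG _).mp S.2)
      have e1 : p • g S = 0 := by rw [← map_nsmul, e0, map_zero]
      have e2 : p • ιk (g S) = 0 :=
        ((map_nsmul ιk p (g S)).symm.trans (congrArg ιk e1)).trans (map_zero ιk)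
      change (p : ℤ) • ιk (g S) = 0
      rw [natCast_zsmul]
      exact e2
    set j : g.range → geomTorsion Ebar (p : ℤ) := fun R ↦ ⟨_, hmem R⟩ with hj
    have hjinj : Function.Injective j := by
      intro R R' hRR'
      have h := congrArg Subtype.val hRR'
      exact Subtype.ext (hinjι h)
    calc Nat.card g.range ≤ Nat.card (geomTorsion Ebar (p : ℤ)) :=
          Nat.card_le_card_of_injective j hjinj
      _ ≤ p := natCard_geomTorsion_expChar_le Ebar p
  -- hence `#(ker g) ≥ p`
  have hker : p ≤ Nat.card g.ker := by
    have h1 := AddSubgroup.card_eq_card_quotient_mul_card_addSubgroup g.ker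
    have h2 : Nat.card (G ⧸ g.ker) = Nat.card g.range :=
      Nat.card_congr (QuotientAddGroup.quotientKerEquivRange g).toEquiv
    rw [hcardG, h2] at h1
    by_contra hlt
    push Not at hlt
    have : p ^ 2 ≤ p * Nat.card g.ker := by
      rw [h1]; exact Nat.mul_le_mul_right _ hrange
    nlinarith [hp.pos]
  /- (2) the rational point `P`, read in `X(K̄_v)` -/
  set ι : v.adicCompletion K →ₐ[v.adicCompletion K] AlgebraicClosure (v.adicCompletion K) :=
    Algebra.ofId (v.adicCompletion K) (AlgebraicClosure (v.adicCompletion K)) with hιdef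
  set P' : ((X₀.baseChange (v.adicCompletion K)).baseChange
      (AlgebraicClosure (v.adicCompletion K))).toAffine.Point :=
    Affine.Point.map (W' := (X₀.baseChange (v.adicCompletion K)).toAffine)
      (S := v.adicCompletion K) ι P with hP'def
  have hP'fix : ∀ σ : AlgebraicClosure (v.adicCompletion K) →ₐ[v.adicCompletion K]
      AlgebraicClosure (v.adicCompletion K), Affine.Point.map σ P' = P' := by
    intro σ
    rw [hP'def, Affine.Point.map_map]
    have hσι : σ.comp ι = ι := AlgHom.ext fun x ↦ by
      rw [AlgHom.comp_apply, hιdef, Algebra.ofId_apply, AlgHom.commutes]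
    rw [hσι]
  have hpP' : p • P' = 0 := by
    rw [hP'def, ← map_nsmul]
    exact (congrArg (Affine.Point.map (W' := (X₀.baseChange (v.adicCompletion K)).toAffine)
      (S := v.adicCompletion K) ι) hpP).trans (map_zero _)
  have hP'0 : P' ≠ 0 := by
    intro h0
    apply hP0
    exact Affine.Point.map_injective (W' := (X₀.baseChange (v.adicCompletion K)).toAffine)
      (f := ι) (h0.trans (map_zero _).symm)
  have hP'E₁ : ¬ W₀.ReducesToZero (Affine.Point.congrEquiv hX P') := by
    intro h1
    rcases point_cases hvR P with hP | ⟨x, y, h, hP, hx⟩ | ⟨a, c, h, hP⟩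
    · exact hP0 hP
    · exact (not_mem_range_iff hvR).mpr hx ⟨⟨x, hPint h hP⟩, rfl⟩
    · subst hP
      have h' : ((X₀.baseChange (v.adicCompletion K)).baseChange
          (v.adicCompletion K)).toAffine.Nonsingular
          (algebraMap (v.adicCompletionIntegers K) (v.adicCompletion K) a)
          (algebraMap (v.adicCompletionIntegers K) (v.adicCompletion K) c) := h
      have hmap : P' = Affine.Point.map (W' := (X₀.baseChange (v.adicCompletion K)).toAffine)
          (S := v.adicCompletion K) ι (.some _ _ h') := rfl
      rw [hmap, Affine.Point.map_some, Affine.Point.congrEquiv_some, reducesToZero_some_iff,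
        not_mem_range_iff hv0] at h1
      exact absurd ((Valuation.mem_integer_iff _ _).mp (hfle a)) (not_le.mpr h1)
  /- (3) Mazur's (5.4): `τ S - S ∈ ⟨P⟩` for `τ` with `χ̄_p(τ) = 1` -/
  have hP'T : (P' : geomPoints (X₀.baseChange (v.adicCompletion K))) ∈
      geomTorsion (X₀.baseChange (v.adicCompletion K)) (p : ℤ) :=
    (Submodule.mem_torsionBy_iff _ _).mpr
      (show (p : ℤ) • P' = 0 by rw [natCast_zsmul]; exact hpP')
  set PT : geomTorsion (X₀.baseChange (v.adicCompletion K)) (p : ℤ) := ⟨_, hP'T⟩ with hPTdef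
  have hPT0 : PT ≠ 0 := fun h ↦ hP'0 (congrArg Subtype.val h)
  have hPTfix : ∀ σ : absoluteGaloisGroup (v.adicCompletion K), σ • PT = PT :=
    fun σ ↦ Subtype.ext (hP'fix _)
  have hχ : ((modPCyclotomicCharacterZMod (v.adicCompletion K) p τ : (ZMod p)ˣ) : ZMod p).val = 1 := by
    obtain ⟨ζ, hζ⟩ := HasEnoughRootsOfUnity.exists_primitiveRoot
      (AlgebraicClosure (v.adicCompletion K)) p
    have hspec := modPCyclotomicCharacterZMod_spec (v.adicCompletion K) p τ ζ hζ.pow_eq_one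
    rw [hτ ζ hζ.pow_eq_one] at hspec
    exact (hζ.pow_inj (ZMod.val_lt _) hp.one_lt (by rw [pow_one]; exact hspec.symm))
  have h54 : ∀ S : geomTorsion (X₀.baseChange (v.adicCompletion K)) (p : ℤ),
      τ • S - S ∈ AddSubgroup.zmultiples PT := fun S ↦ by
    have h := smul_sub_cyclotomic_smul_mem_zmultiples (X₀.baseChange (v.adicCompletion K)) p
      hPT0 hPTfix τ S
    rwa [hχ, one_smul] at h
  /- (4) `τ` fixes the `p`-torsion in the kernel of reduction: `⟨P⟩ ∩ E₁ = 0` -/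
  set E₁ : AddSubgroup ((X₀.baseChange (v.adicCompletion K)).baseChange
      (AlgebraicClosure (v.adicCompletion K))).toAffine.Point :=
    (W₀.kernelOfReduction hv0).comap (Affine.Point.congrEquiv hX).toAddMonoidHom with hE₁def
  have hmemE₁ : ∀ R, R ∈ E₁ ↔ W₀.ReducesToZero (Affine.Point.congrEquiv hX R) := fun R ↦ Iff.rfl
  have hcardZ : Nat.card (AddSubgroup.zmultiples P') = p := by
    rw [Nat.card_zmultiples, addOrderOf_eq_prime hpP' hP'0]
  haveI hZfin : Finite (AddSubgroup.zmultiples P') :=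
    Nat.finite_of_card_ne_zero (by rw [hcardZ]; exact hp.ne_zero)
  have hZE₁ : AddSubgroup.zmultiples P' ⊓ E₁ = ⊥ := by
    have hle : AddSubgroup.zmultiples P' ⊓ E₁ ≤ AddSubgroup.zmultiples P' := inf_le_left
    have hdvd : Nat.card ↥(AddSubgroup.zmultiples P' ⊓ E₁) ∣ p :=
      hcardZ ▸ AddSubgroup.card_dvd_of_le hle
    rcases (Nat.dvd_prime hp).mp hdvd with h1 | hpp
    · exact AddSubgroup.eq_bot_of_card_eq _ h1
    · exfalso
      have heq := AddSubgroup.eq_of_le_of_card_ge hle (by rw [hpp, hcardZ])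
      have hmem : P' ∈ AddSubgroup.zmultiples P' ⊓ E₁ := by
        rw [heq]; exact AddSubgroup.mem_zmultiples P'
      exact hP'E₁ ((hmemE₁ _).mp hmem.2)
  have hτiso : ∀ z, w ((absoluteGaloisGroup.toAlgEquiv _ τ :
      AlgebraicClosure (v.adicCompletion K) ≃ₐ[v.adicCompletion K]
        AlgebraicClosure (v.adicCompletion K)) z) = w z :=
    fun z ↦ spectralValuation_smul hw τ z
  have hkerfix : ∀ S : G, S ∈ g.ker →
      Affine.Point.map ((absoluteGaloisGroup.toAlgEquiv _ τ :
          AlgebraicClosure (v.adicCompletion K) ≃ₐ[v.adicCompletion K]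
            AlgebraicClosure (v.adicCompletion K)) :
          AlgebraicClosure (v.adicCompletion K) →ₐ[v.adicCompletion K]
            AlgebraicClosure (v.adicCompletion K))
        (S : ((X₀.baseChange (v.adicCompletion K)).baseChange
          (AlgebraicClosure (v.adicCompletion K))).toAffine.Point) = S := by
    intro S hS
    have h1 : W₀.ReducesToZero (Affine.Point.congrEquiv hX (S : ((X₀.baseChange
        (v.adicCompletion K)).baseChange (AlgebraicClosure (v.adicCompletion K))).toAffine.Point)) :=
      (hmemker S).mp hS
    have h2 := (W₀.reducesToZero_congrEquiv_map_iff hX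
      ((absoluteGaloisGroup.toAlgEquiv _ τ :
          AlgebraicClosure (v.adicCompletion K) ≃ₐ[v.adicCompletion K]
            AlgebraicClosure (v.adicCompletion K)) :
          AlgebraicClosure (v.adicCompletion K) →ₐ[v.adicCompletion K]
            AlgebraicClosure (v.adicCompletion K)) hτiso (S : ((X₀.baseChange
        (v.adicCompletion K)).baseChange (AlgebraicClosure (v.adicCompletion K))).toAffine.Point)).mpr h1
    have h3 : (Affine.Point.map ((absoluteGaloisGroup.toAlgEquiv _ τ :
          AlgebraicClosure (v.adicCompletion K) ≃ₐ[v.adicCompletion K]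
            AlgebraicClosure (v.adicCompletion K)) :
          AlgebraicClosure (v.adicCompletion K) →ₐ[v.adicCompletion K]
            AlgebraicClosure (v.adicCompletion K))
        (S : ((X₀.baseChange (v.adicCompletion K)).baseChange
          (AlgebraicClosure (v.adicCompletion K))).toAffine.Point) - S) ∈ E₁ := by
      rw [hmemE₁, map_sub]
      exact h2.sub hv0 h1
    have h4 : (Affine.Point.map ((absoluteGaloisGroup.toAlgEquiv _ τ :
          AlgebraicClosure (v.adicCompletion K) ≃ₐ[v.adicCompletion K]
            AlgebraicClosure (v.adicCompletion K)) :
          AlgebraicClosure (v.adicCompletion K) →ₐ[v.adicCompletion K]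
            AlgebraicClosure (v.adicCompletion K))
        (S : ((X₀.baseChange (v.adicCompletion K)).baseChange
          (AlgebraicClosure (v.adicCompletion K))).toAffine.Point) - S) ∈
        AddSubgroup.zmultiples P' := by
      have hST : ((S : ((X₀.baseChange (v.adicCompletion K)).baseChange
          (AlgebraicClosure (v.adicCompletion K))).toAffine.Point) :
            geomPoints (X₀.baseChange (v.adicCompletion K))) ∈
          geomTorsion (X₀.baseChange (v.adicCompletion K)) (p : ℤ) :=
        (Submodule.mem_torsionBy_iff _ _).mpr
          (show (p : ℤ) • (S : ((X₀.baseChange (v.adicCompletion K)).baseChange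
            (AlgebraicClosure (v.adicCompletion K))).toAffine.Point) = 0 by
            rw [natCast_zsmul]; exact (hmemG _).mp S.2)
      obtain ⟨k, hk⟩ := AddSubgroup.mem_zmultiples_iff.mp (h54 ⟨_, hST⟩)
      refine AddSubgroup.mem_zmultiples_iff.mpr ⟨k, ?_⟩
      have hk' := congrArg Subtype.val hk
      simp only [AddSubgroupClass.coe_sub,
        Literature.NumberTheory.EllipticCurves.AddSubgroup.torsionBy.coe_smul] at hk'
      exact hk'
    have h5 : (Affine.Point.map ((absoluteGaloisGroup.toAlgEquiv _ τ :
          AlgebraicClosure (v.adicCompletion K) ≃ₐ[v.adicCompletion K]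
            AlgebraicClosure (v.adicCompletion K)) :
          AlgebraicClosure (v.adicCompletion K) →ₐ[v.adicCompletion K]
            AlgebraicClosure (v.adicCompletion K))
        (S : ((X₀.baseChange (v.adicCompletion K)).baseChange
          (AlgebraicClosure (v.adicCompletion K))).toAffine.Point) - S) ∈
        AddSubgroup.zmultiples P' ⊓ E₁ := ⟨h4, h3⟩
    rw [hZE₁, AddSubgroup.mem_bot, sub_eq_zero] at h5
    exact h5
  /- (5) counting: the fixed subgroup of `E[p]` contains `ker g` (order `≥ p`) and `P ∉ ker g` -/
  set τ' : AlgebraicClosure (v.adicCompletion K) →ₐ[v.adicCompletion K]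
      AlgebraicClosure (v.adicCompletion K) :=
    ((absoluteGaloisGroup.toAlgEquiv _ τ :
        AlgebraicClosure (v.adicCompletion K) ≃ₐ[v.adicCompletion K]
          AlgebraicClosure (v.adicCompletion K)) :
        AlgebraicClosure (v.adicCompletion K) →ₐ[v.adicCompletion K]
          AlgebraicClosure (v.adicCompletion K)) with hτ'def
  set Fix : AddSubgroup ((X₀.baseChange (v.adicCompletion K)).baseChange
      (AlgebraicClosure (v.adicCompletion K))).toAffine.Point :=
    (Affine.Point.map (W' := (X₀.baseChange (v.adicCompletion K)).toAffine) τ' -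
      AddMonoidHom.id _).ker with hFixdef
  have hmemFix : ∀ R, R ∈ Fix ↔ Affine.Point.map τ' R = R := fun R ↦ by
    rw [hFixdef, AddMonoidHom.mem_ker, AddMonoidHom.sub_apply, AddMonoidHom.id_apply, sub_eq_zero]
  set H : AddSubgroup _ := Fix ⊓ G with hHdef
  set Kr : AddSubgroup ((X₀.baseChange (v.adicCompletion K)).baseChange
      (AlgebraicClosure (v.adicCompletion K))).toAffine.Point := g.ker.map G.subtype with hKrdef
  have hcardKr : Nat.card Kr = Nat.card g.ker := AddSubgroup.card_subtype G g.ker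
  have hKrH : Kr ≤ H := by
    rintro R ⟨S, hS, rfl⟩
    exact ⟨(hmemFix _).mpr (hkerfix S hS), S.2⟩
  have hP'H : P' ∈ H := ⟨(hmemFix _).mpr (hP'fix τ'), (hmemG _).mpr hpP'⟩
  have hP'Kr : P' ∉ Kr := by
    rintro ⟨S, hS, hSP⟩
    have h1 := (hmemker S).mp hS
    rw [show (S : ((X₀.baseChange (v.adicCompletion K)).baseChange
        (AlgebraicClosure (v.adicCompletion K))).toAffine.Point) = P' from hSP] at h1
    exact hP'E₁ h1
  have hHle : H ≤ G := inf_le_right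
  haveI hHfin : Finite H := Finite.of_injective _ (AddSubgroup.inclusion_injective hHle)
  have hHdvd : Nat.card H ∣ p ^ 2 := hcardG ▸ AddSubgroup.card_dvd_of_le hHle
  obtain ⟨i, hi, hcardH⟩ := (Nat.dvd_prime_pow hp).mp hHdvd
  have hHG : H = G := by
    have hi2 : i = 2 := by
      by_contra hne
      have hle : Nat.card H ≤ Nat.card Kr := by
        rw [hcardH, hcardKr]
        calc p ^ i ≤ p ^ 1 := Nat.pow_le_pow_right hp.pos (by omega)
          _ = p := pow_one p
          _ ≤ Nat.card g.ker := hker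
      have heq := AddSubgroup.eq_of_le_of_card_ge hKrH hle
      exact hP'Kr (heq ▸ hP'H)
    refine AddSubgroup.eq_of_le_of_card_ge hHle ?_
    rw [hcardH, hi2, hcardG]
  have hQG : Q ∈ G := (hmemG _).mpr hQ
  rw [← hHG] at hQG
  exact (hmemFix _).mp hQG.1

set_option maxHeartbeats 4000000 in
/-- **At a multiplicative place `v ∣ p`, a `K_v`-rational `p`-torsion point off `E₀` makes
`E[p] ≅ ℤ/p ⊕ μ_p` locally** (model form; `p` odd).  Let `X` be a minimal Weierstrass equation over
`K_v` of an elliptic curve with multiplicative reduction, `p` the (odd) residue characteristic of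
`v`, and `P ∈ X(K_v)` with `p P = O` not in `E₀(K_v)`.  Then every `τ ∈ Γ_{K_v}` fixing the `p`-th
roots of unity of `K̄_v` fixes every `Q ∈ X(K̄_v)` with `p Q = O`.  This is Mazur's Step 4 (iii) at
the prime `q = N` (1977, III.§5, p. 160: "`q` a rational prime of bad reduction for `E`: Since
`ℤ/N_{/𝔽_q} ⊄ (E_{/𝔽_q})⁰` by step 3, one obtains, as in (ii), `E[N]_{/ℤ_q} ≅ ℤ/N_{/ℤ_q} × μ_{N/ℤ_q}`"),
proved without the Tate curve: the reduction is a node, whose Hasse invariant is non-zero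
(`hasseCoeff_ne_zero_of_node`: the multiplicative group is ordinary), so `ΨSq_p` has a root of
valuation `> 1` (`card_roots_ΨSq_prime_filter_one_lt_valuation`) — a point `S₀ ≠ O` of order `p`
in the kernel of reduction `E₁`; `⟨P⟩ ∩ E₁ = 0` (`P ∉ E₀ ⊇ E₁`), and `τ S - χ̄_p(τ) S ∈ ⟨P⟩`
(Mazur's (5.4), `smul_sub_cyclotomic_smul_mem_zmultiples`), so a `τ` with `χ̄_p(τ) = 1` fixes
`S₀` and `P`, which generate `X(K̄_v)[p]`.
[cite: Mazur1977, Ch. III §5, Step 4 (iii), p. 160]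
[cite: SilvermanAEC2009, VII.2.1, VII.3.1, V.4.1(a), Exercise 3.7, Cor. III.6.4(b)] -/
theorem map_eq_of_forall_pow_eq_one_of_not_mem_goodReductionSubgroup
    (X : WeierstrassCurve (v.adicCompletion K)) [X.IsElliptic]
    [hmult : X.HasMultiplicativeReduction (v.adicCompletionIntegers K)]
    {p : ℕ} (hp : p.Prime) (hp2 : p ≠ 2) (hpv : (p : 𝓞 K) ∈ v.asIdeal)
    {P : X.toAffine.Point} (hpP : p • P = 0)
    (hP : P ∉ X.goodReductionSubgroup (v.adicCompletionIntegers K))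
    {τ : absoluteGaloisGroup (v.adicCompletion K)}
    (hτ : ∀ ζ : AlgebraicClosure (v.adicCompletion K), ζ ^ p = 1 → τ • ζ = ζ)
    (Q : (X.baseChange (AlgebraicClosure (v.adicCompletion K))).toAffine.Point) (hQ : p • Q = 0) :
    Affine.Point.map ((absoluteGaloisGroup.toAlgEquiv _ τ :
        AlgebraicClosure (v.adicCompletion K) ≃ₐ[v.adicCompletion K]
          AlgebraicClosure (v.adicCompletion K)) :
        AlgebraicClosure (v.adicCompletion K) →ₐ[v.adicCompletion K]
          AlgebraicClosure (v.adicCompletion K)) Q = Q := by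
  obtain ⟨w, hw⟩ := v.exists_spectralValuation
  have hv0 : w.Integers w.integer := Valuation.integer.integers w
  haveI := isAlgClosed_residueField_integer w
  haveI : Fact p.Prime := ⟨hp⟩
  haveI : CharZero (v.adicCompletion K) :=
    charZero_of_injective_algebraMap (algebraMap K (v.adicCompletion K)).injective
  have hpF : (p : v.adicCompletion K) ≠ 0 := Nat.cast_ne_zero.mpr hp.ne_zero
  haveI : NeZero (p : v.adicCompletion K) := ⟨hpF⟩
  have hpL : ((p : ℕ) : AlgebraicClosure (v.adicCompletion K)) ≠ 0 := fun h ↦ hpF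
    ((algebraMap (v.adicCompletion K) (AlgebraicClosure (v.adicCompletion K))).injective
      (by rw [map_natCast, map_zero, h]))
  haveI : NeZero ((p : ℕ) : AlgebraicClosure (v.adicCompletion K)) := ⟨hpL⟩
  -- write `X = X₀ ⊗ K_v`
  obtain ⟨X₀, rfl⟩ : ∃ X₀ : WeierstrassCurve (v.adicCompletionIntegers K),
      X = X₀.baseChange (v.adicCompletion K) := IsIntegral.integral
  have hvR := integers_valuationRing_valuation (v.adicCompletionIntegers K) (v.adicCompletion K)
  rw [goodReductionSubgroup_baseChange_eq, mem_nonsingularReductionSubgroup_iff] at hP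
  -- multiplicative reduction: `Δ ∈ 𝔪_v`, `c₄ ∉ 𝔪_v`
  have eΔ : (X₀.baseChange (v.adicCompletion K)).Δ =
      algebraMap (v.adicCompletionIntegers K) (v.adicCompletion K) X₀.Δ := map_Δ X₀ _
  have ec : (X₀.baseChange (v.adicCompletion K)).c₄ =
      algebraMap (v.adicCompletionIntegers K) (v.adicCompletion K) X₀.c₄ := map_c₄ X₀ _
  have hΔm := hmult.badReduction
  have hc₄u := hmult.multiplicativeReduction
  rw [eΔ, IsDedekindDomain.HeightOneSpectrum.valuation_lt_one_iff_mem] at hΔm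
  rw [ec, IsDedekindDomain.HeightOneSpectrum.valuation_eq_one_iff_notMem] at hc₄u
  -- the ring homomorphism `𝓞_v → 𝒪_w` and the `𝒪_w`-model
  set f : v.adicCompletionIntegers K →+* AlgebraicClosure (v.adicCompletion K) :=
    (algebraMap (v.adicCompletion K) (AlgebraicClosure (v.adicCompletion K))).comp
      (algebraMap (v.adicCompletionIntegers K) (v.adicCompletion K)) with hfdef
  have hfle : ∀ a, f a ∈ w.integer := fun a ↦
    (spectralValuation_algebraMap_le_one_iff hw _).mpr a.2
  set φ₀ : v.adicCompletionIntegers K →+* w.integer := f.codRestrict w.integer hfle with hφ₀def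
  have hφ₀ : ∀ a, ((φ₀ a : w.integer) : AlgebraicClosure (v.adicCompletion K)) = f a := fun a ↦ rfl
  obtain ⟨𝔐, h𝔐⟩ := v.localPrimesAbove_nonempty
  haveI hφ₀loc : IsLocalHom φ₀ := ⟨fun a ha ↦ by
    by_contra hna
    have hmem : a ∈ IsLocalRing.maximalIdeal (v.adicCompletionIntegers K) :=
      (IsLocalRing.mem_maximalIdeal _).mpr (mem_nonunits_iff.mpr hna)
    have hlt : w (f a) < 1 := spectralValuation_algebraMap_lt_one_of_mem_maximalIdeal hw h𝔐 hmem
    have h1 : w (f a) = 1 := by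
      rw [← hφ₀]; exact (hv0.isUnit_iff_valuation_eq_one).mp ha
    exact absurd h1 hlt.ne⟩
  set W₀ : WeierstrassCurve w.integer := X₀.map φ₀ with hW₀def
  have hX : (X₀.baseChange (v.adicCompletion K)).baseChange (AlgebraicClosure (v.adicCompletion K)) =
      W₀.baseChange (AlgebraicClosure (v.adicCompletion K)) := by
    rw [hW₀def]
    change (X₀.map _).map _ = (X₀.map φ₀).map (algebraMap w.integer _)
    rw [map_map, map_map]
    congr 1
  haveI hint : ((X₀.baseChange (v.adicCompletion K)).baseChange
      (AlgebraicClosure (v.adicCompletion K))).IsIntegral w.integer := ⟨W₀, hX⟩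
  have hκ : W₀.map (IsLocalRing.residue w.integer) =
      ((X₀.map (IsLocalRing.residue (v.adicCompletionIntegers K))).map
        (IsLocalRing.ResidueField.map φ₀)) := by
    rw [hW₀def]
    simp only [map_map]
    congr 1
  -- the reduction of `W₀` is a node
  have hW₀Δ : IsLocalRing.residue w.integer W₀.Δ = 0 := by
    rw [IsLocalRing.residue_eq_zero_iff, hW₀def, map_Δ, IsLocalRing.mem_maximalIdeal,
      mem_nonunits_iff, isUnit_map_iff, ← mem_nonunits_iff, ← IsLocalRing.mem_maximalIdeal]
    exact hΔm
  have hW₀c₄ : IsLocalRing.residue w.integer W₀.c₄ ≠ 0 := by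
    rw [Ne, IsLocalRing.residue_eq_zero_iff, hW₀def, map_c₄, IsLocalRing.mem_maximalIdeal,
      mem_nonunits_iff, isUnit_map_iff, ← mem_nonunits_iff, ← IsLocalRing.mem_maximalIdeal]
    exact hc₄u
  -- the residue field has characteristic `p`; the node is ordinary
  have hpw : w (p : AlgebraicClosure (v.adicCompletion K)) < 1 := spectralValuation_natCast_lt_one hw hpv
  haveI : CharP (IsLocalRing.ResidueField w.integer) p :=
    charP_residueField_of_valuation_natCast_lt_one w hpw
  have hA' : (W₀.map (IsLocalRing.residue w.integer)).hasseCoeff p ≠ 0 :=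
    hasseCoeff_ne_zero_of_node hp2 _ (by rw [map_Δ, hW₀Δ]) (by rw [map_c₄]; exact hW₀c₄)
  have hA : w (((X₀.baseChange (v.adicCompletion K)).baseChange
      (AlgebraicClosure (v.adicCompletion K))).hasseCoeff p) = 1 := by
    rw [hX, show W₀.baseChange (AlgebraicClosure (v.adicCompletion K)) =
      W₀.map (algebraMap w.integer (AlgebraicClosure (v.adicCompletion K))) from rfl, map_hasseCoeff]
    refine (residue_ne_zero_iff_valuation_eq_one w _).mp ?_
    rwa [← map_hasseCoeff]
  /- (1) a point `S₀ ≠ O` of order `p` in the kernel of reduction -/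
  have hroots := card_roots_ΨSq_prime_filter_one_lt_valuation w
    ((X₀.baseChange (v.adicCompletion K)).baseChange (AlgebraicClosure (v.adicCompletion K)))
    hp2 hpw hpL hA
  have hΨ0 : ((X₀.baseChange (v.adicCompletion K)).baseChange
      (AlgebraicClosure (v.adicCompletion K))).ΨSq p ≠ 0 :=
    ΨSq_ne_zero _ (n := p) (by exact_mod_cast hpL)
  obtain ⟨x₀, hx₀⟩ : ∃ x₀, x₀ ∈ (((X₀.baseChange (v.adicCompletion K)).baseChange
      (AlgebraicClosure (v.adicCompletion K))).ΨSq p).roots.filter fun a => 1 < w a := by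
    refine Multiset.card_pos_iff_exists_mem.mp ?_
    rw [hroots]
    have := hp.two_le
    omega
  rw [Multiset.mem_filter, Polynomial.mem_roots hΨ0, Polynomial.IsRoot.def] at hx₀
  obtain ⟨y₀, hy₀⟩ := WeierstrassCurve.exists_equation
    ((X₀.baseChange (v.adicCompletion K)).baseChange (AlgebraicClosure (v.adicCompletion K))) x₀
  have h₀ : ((X₀.baseChange (v.adicCompletion K)).baseChange
      (AlgebraicClosure (v.adicCompletion K))).toAffine.Nonsingular x₀ y₀ :=
    Affine.equation_iff_nonsingular.mp hy₀
  set S₀ : ((X₀.baseChange (v.adicCompletion K)).baseChange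
      (AlgebraicClosure (v.adicCompletion K))).toAffine.Point := .some x₀ y₀ h₀ with hS₀def
  have hpS₀ : p • S₀ = 0 := by
    rw [hS₀def, ← natCast_zsmul]
    exact (zsmul_some_eq_zero_iff_eval_ΨSq _ h₀ (p : ℤ)).mpr hx₀.1
  have hS₀ne : S₀ ≠ 0 := Affine.Point.some_ne_zero h₀
  have hS₀E₁ : W₀.ReducesToZero (Affine.Point.congrEquiv hX S₀) := by
    rw [hS₀def, Affine.Point.congrEquiv_some, reducesToZero_some_iff, not_mem_range_iff hv0]
    exact hx₀.2
  /- (2) the rational point `P`, read in `X(K̄_v)`: fixed by `Γ_{K_v}`, off `E₀ ⊇ E₁` -/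
  set ι : v.adicCompletion K →ₐ[v.adicCompletion K] AlgebraicClosure (v.adicCompletion K) :=
    Algebra.ofId (v.adicCompletion K) (AlgebraicClosure (v.adicCompletion K)) with hιdef
  set P' : ((X₀.baseChange (v.adicCompletion K)).baseChange
      (AlgebraicClosure (v.adicCompletion K))).toAffine.Point :=
    Affine.Point.map (W' := (X₀.baseChange (v.adicCompletion K)).toAffine)
      (S := v.adicCompletion K) ι P with hP'def
  have hP'fix : ∀ σ : AlgebraicClosure (v.adicCompletion K) →ₐ[v.adicCompletion K]
      AlgebraicClosure (v.adicCompletion K), Affine.Point.map σ P' = P' := by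
    intro σ
    rw [hP'def, Affine.Point.map_map]
    have hσι : σ.comp ι = ι := AlgHom.ext fun x ↦ by
      rw [AlgHom.comp_apply, hιdef, Algebra.ofId_apply, AlgHom.commutes]
    rw [hσι]
  have hpP' : p • P' = 0 := by
    rw [hP'def, ← map_nsmul]
    exact (congrArg (Affine.Point.map (W' := (X₀.baseChange (v.adicCompletion K)).toAffine)
      (S := v.adicCompletion K) ι) hpP).trans (map_zero _)
  have hP'E₀ : ¬ W₀.HasNonsingularReduction (Affine.Point.congrEquiv hX P') := by
    intro hns
    apply hP
    rcases point_cases hvR P with rfl | ⟨x, y, h, rfl, hx⟩ | ⟨a, c, h, rfl⟩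
    · exact hasNonsingularReduction_zero
    · exact Or.inl ((not_mem_range_iff hvR).mpr hx)
    · rw [hasNonsingularReduction_some_algebraMap_iff hvR.hom_inj h]
      have h' : ((X₀.baseChange (v.adicCompletion K)).baseChange
          (v.adicCompletion K)).toAffine.Nonsingular
          (algebraMap (v.adicCompletionIntegers K) (v.adicCompletion K) a)
          (algebraMap (v.adicCompletionIntegers K) (v.adicCompletion K) c) := h
      have hmap : P' = Affine.Point.map (W' := (X₀.baseChange (v.adicCompletion K)).toAffine)
          (S := v.adicCompletion K) ι (.some _ _ h') := rfl
      rw [hmap, Affine.Point.map_some, Affine.Point.congrEquiv_some] at hns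
      have hns' := (hasNonsingularReduction_some_algebraMap_iff hv0.hom_inj
        (a := φ₀ a) (b := φ₀ c) _).mp hns
      rw [hκ, ← IsLocalRing.ResidueField.map_residue, ← IsLocalRing.ResidueField.map_residue] at hns'
      exact (Affine.map_nonsingular _ (IsLocalRing.ResidueField.map φ₀).injective _ _).mp hns'
  have hP'E₁ : ¬ W₀.ReducesToZero (Affine.Point.congrEquiv hX P') :=
    fun h ↦ hP'E₀ h.hasNonsingularReduction
  have hP'0 : P' ≠ 0 := by
    intro h0
    apply hP'E₀
    rw [h0, map_zero]
    exact hasNonsingularReduction_zero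
  /- (3) Mazur's (5.4): `τ S - S ∈ ⟨P⟩` for `τ` with `χ̄_p(τ) = 1` -/
  have hP'T : (P' : geomPoints (X₀.baseChange (v.adicCompletion K))) ∈
      geomTorsion (X₀.baseChange (v.adicCompletion K)) (p : ℤ) :=
    (Submodule.mem_torsionBy_iff _ _).mpr
      (show (p : ℤ) • P' = 0 by rw [natCast_zsmul]; exact hpP')
  set PT : geomTorsion (X₀.baseChange (v.adicCompletion K)) (p : ℤ) := ⟨_, hP'T⟩ with hPTdef
  have hPT0 : PT ≠ 0 := fun h ↦ hP'0 (congrArg Subtype.val h)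
  have hPTfix : ∀ σ : absoluteGaloisGroup (v.adicCompletion K), σ • PT = PT :=
    fun σ ↦ Subtype.ext (hP'fix _)
  have hχ : ((modPCyclotomicCharacterZMod (v.adicCompletion K) p τ : (ZMod p)ˣ) : ZMod p).val = 1 := by
    obtain ⟨ζ, hζ⟩ := HasEnoughRootsOfUnity.exists_primitiveRoot
      (AlgebraicClosure (v.adicCompletion K)) p
    have hspec := modPCyclotomicCharacterZMod_spec (v.adicCompletion K) p τ ζ hζ.pow_eq_one
    rw [hτ ζ hζ.pow_eq_one] at hspec
    exact (hζ.pow_inj (ZMod.val_lt _) hp.one_lt (by rw [pow_one]; exact hspec.symm))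
  have h54 : ∀ S : geomTorsion (X₀.baseChange (v.adicCompletion K)) (p : ℤ),
      τ • S - S ∈ AddSubgroup.zmultiples PT := fun S ↦ by
    have h := smul_sub_cyclotomic_smul_mem_zmultiples (X₀.baseChange (v.adicCompletion K)) p
      hPT0 hPTfix τ S
    rwa [hχ, one_smul] at h
  /- (4) `⟨P⟩ ∩ E₁ = 0`, so `τ` fixes `S₀` -/
  set E₁ : AddSubgroup ((X₀.baseChange (v.adicCompletion K)).baseChange
      (AlgebraicClosure (v.adicCompletion K))).toAffine.Point :=
    (W₀.kernelOfReduction hv0).comap (Affine.Point.congrEquiv hX).toAddMonoidHom with hE₁def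
  have hmemE₁ : ∀ R, R ∈ E₁ ↔ W₀.ReducesToZero (Affine.Point.congrEquiv hX R) := fun R ↦ Iff.rfl
  have hcardZ : Nat.card (AddSubgroup.zmultiples P') = p := by
    rw [Nat.card_zmultiples, addOrderOf_eq_prime hpP' hP'0]
  haveI hZfin : Finite (AddSubgroup.zmultiples P') :=
    Nat.finite_of_card_ne_zero (by rw [hcardZ]; exact hp.ne_zero)
  have hZE₁ : AddSubgroup.zmultiples P' ⊓ E₁ = ⊥ := by
    have hle : AddSubgroup.zmultiples P' ⊓ E₁ ≤ AddSubgroup.zmultiples P' := inf_le_left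
    have hdvd : Nat.card ↥(AddSubgroup.zmultiples P' ⊓ E₁) ∣ p :=
      hcardZ ▸ AddSubgroup.card_dvd_of_le hle
    rcases (Nat.dvd_prime hp).mp hdvd with h1 | hpp
    · exact AddSubgroup.eq_bot_of_card_eq _ h1
    · exfalso
      have heq := AddSubgroup.eq_of_le_of_card_ge hle (by rw [hpp, hcardZ])
      have hmem : P' ∈ AddSubgroup.zmultiples P' ⊓ E₁ := by
        rw [heq]; exact AddSubgroup.mem_zmultiples P'
      exact hP'E₁ ((hmemE₁ _).mp hmem.2)
  set τ' : AlgebraicClosure (v.adicCompletion K) →ₐ[v.adicCompletion K]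
      AlgebraicClosure (v.adicCompletion K) :=
    ((absoluteGaloisGroup.toAlgEquiv _ τ :
        AlgebraicClosure (v.adicCompletion K) ≃ₐ[v.adicCompletion K]
          AlgebraicClosure (v.adicCompletion K)) :
        AlgebraicClosure (v.adicCompletion K) →ₐ[v.adicCompletion K]
          AlgebraicClosure (v.adicCompletion K)) with hτ'def
  have hτiso : ∀ z, w (τ' z) = w z := fun z ↦ spectralValuation_smul hw τ z
  have hS₀fix : Affine.Point.map τ' S₀ = S₀ := by
    have h2 : W₀.ReducesToZero (Affine.Point.congrEquiv hX (Affine.Point.map τ' S₀)) :=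
      (W₀.reducesToZero_congrEquiv_map_iff hX τ' hτiso S₀).mpr hS₀E₁
    have h3 : Affine.Point.map τ' S₀ - S₀ ∈ E₁ := by
      rw [hmemE₁, map_sub]
      exact h2.sub hv0 hS₀E₁
    have h4 : Affine.Point.map τ' S₀ - S₀ ∈ AddSubgroup.zmultiples P' := by
      have hST : ((S₀ : ((X₀.baseChange (v.adicCompletion K)).baseChange
          (AlgebraicClosure (v.adicCompletion K))).toAffine.Point) :
            geomPoints (X₀.baseChange (v.adicCompletion K))) ∈
          geomTorsion (X₀.baseChange (v.adicCompletion K)) (p : ℤ) :=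
        (Submodule.mem_torsionBy_iff _ _).mpr
          (show (p : ℤ) • S₀ = 0 by rw [natCast_zsmul]; exact hpS₀)
      obtain ⟨k, hk⟩ := AddSubgroup.mem_zmultiples_iff.mp (h54 ⟨_, hST⟩)
      refine AddSubgroup.mem_zmultiples_iff.mpr ⟨k, ?_⟩
      have hk' := congrArg Subtype.val hk
      simp only [AddSubgroupClass.coe_sub,
        Literature.NumberTheory.EllipticCurves.AddSubgroup.torsionBy.coe_smul] at hk'
      exact hk'
    have h5 : Affine.Point.map τ' S₀ - S₀ ∈ AddSubgroup.zmultiples P' ⊓ E₁ := ⟨h4, h3⟩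
    rw [hZE₁, AddSubgroup.mem_bot, sub_eq_zero] at h5
    exact h5
  /- (5) counting in `X(K̄_v)[p]`, of order `p²` -/
  set G := torsionPoints (X₀.baseChange (v.adicCompletion K))
    (AlgebraicClosure (v.adicCompletion K)) p with hGdef
  have hcardG : Nat.card G = p ^ 2 :=
    card_torsionPoints_eq_sq_holds (X₀.baseChange (v.adicCompletion K))
      (AlgebraicClosure (v.adicCompletion K)) hpL
  have hmemG : ∀ R : ((X₀.baseChange (v.adicCompletion K)).baseChange
      (AlgebraicClosure (v.adicCompletion K))).toAffine.Point, R ∈ G ↔ p • R = 0 := fun R ↦ by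
    rw [hGdef, mem_torsionPoints_iff, natCast_zsmul]
  set Fix : AddSubgroup ((X₀.baseChange (v.adicCompletion K)).baseChange
      (AlgebraicClosure (v.adicCompletion K))).toAffine.Point :=
    (Affine.Point.map (W' := (X₀.baseChange (v.adicCompletion K)).toAffine) τ' -
      AddMonoidHom.id _).ker with hFixdef
  have hmemFix : ∀ R, R ∈ Fix ↔ Affine.Point.map τ' R = R := fun R ↦ by
    rw [hFixdef, AddMonoidHom.mem_ker, AddMonoidHom.sub_apply, AddMonoidHom.id_apply, sub_eq_zero]
  set H : AddSubgroup _ := Fix ⊓ G with hHdef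
  have hS₀H : S₀ ∈ H := ⟨(hmemFix _).mpr hS₀fix, (hmemG _).mpr hpS₀⟩
  have hzH : AddSubgroup.zmultiples S₀ ≤ H := AddSubgroup.zmultiples_le_of_mem hS₀H
  have hzE₁ : AddSubgroup.zmultiples S₀ ≤ E₁ :=
    AddSubgroup.zmultiples_le_of_mem ((hmemE₁ _).mpr hS₀E₁)
  have hP'H : P' ∈ H := ⟨(hmemFix _).mpr (hP'fix τ'), (hmemG _).mpr hpP'⟩
  have hP'z : P' ∉ AddSubgroup.zmultiples S₀ := fun h ↦ hP'E₁ ((hmemE₁ _).mp (hzE₁ h))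
  have hHle : H ≤ G := inf_le_right
  haveI hGfin : Finite G := Nat.finite_of_card_ne_zero (by rw [hcardG]; exact pow_ne_zero _ hp.ne_zero)
  haveI hHfin : Finite H := Finite.of_injective _ (AddSubgroup.inclusion_injective hHle)
  have hcardz : Nat.card (AddSubgroup.zmultiples S₀) = p := by
    rw [Nat.card_zmultiples, addOrderOf_eq_prime hpS₀ hS₀ne]
  have hHdvd : Nat.card H ∣ p ^ 2 := hcardG ▸ AddSubgroup.card_dvd_of_le hHle
  obtain ⟨i, hi, hcardH⟩ := (Nat.dvd_prime_pow hp).mp hHdvd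
  have hHG : H = G := by
    have hi2 : i = 2 := by
      by_contra hne
      have hle : Nat.card H ≤ Nat.card (AddSubgroup.zmultiples S₀) := by
        rw [hcardH, hcardz]
        calc p ^ i ≤ p ^ 1 := Nat.pow_le_pow_right hp.pos (by omega)
          _ = p := pow_one p
      have heq := AddSubgroup.eq_of_le_of_card_ge hzH hle
      exact hP'z (heq ▸ hP'H)
    refine AddSubgroup.eq_of_le_of_card_ge hHle ?_
    rw [hcardH, hi2, hcardG]
  have hQG : Q ∈ G := (hmemG _).mpr hQ
  rw [← hHG] at hQG
  exact (hmemFix _).mp hQG.1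

/-- **The same for an elliptic curve `E/K` and its local points `E(K̄_v)`** at a place `v ∣ p` of
good reduction: if the minimal model `E.localMinimalModel v` has a `K_v`-rational point `P ≠ O` with
`p P = O` and integral abscissa, then every `τ ∈ Γ_{K_v}` fixing the `p`-th roots of unity fixes
`E(K̄_v)[p]` (transport of `map_eq_of_forall_pow_eq_one_of_hasGoodReduction` along the equivariant
`E(K̄_v) ≃ X(K̄_v)`, `exists_addEquiv_localPoints_of_smul_eq`).  Mazur 1977, III.§5, Step 4 (ii).
[cite: Mazur1977, Ch. III §5, Step 4 (ii), p. 160] -/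
theorem smul_localPoints_eq_of_forall_pow_eq_one_of_hasGoodReductionAt
    (W : WeierstrassCurve K) [W.IsElliptic] (hgood : W.HasGoodReductionAt v)
    {p : ℕ} (hp : p.Prime) (hpv : (p : 𝓞 K) ∈ v.asIdeal)
    {P : (W.localMinimalModel v).toAffine.Point} (hpP : p • P = 0) (hP0 : P ≠ 0)
    (hPint : ∀ {x y : v.adicCompletion K} (h : (W.localMinimalModel v).toAffine.Nonsingular x y),
      P = .some x y h → x ∈ v.adicCompletionIntegers K)
    {τ : absoluteGaloisGroup (v.adicCompletion K)}
    (hτ : ∀ ζ : AlgebraicClosure (v.adicCompletion K), ζ ^ p = 1 → τ • ζ = ζ)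
    (Q : localPoints W (v.adicCompletion K)) (hQ : p • Q = 0) : τ • Q = Q := by
  haveI : (W.localMinimalModel v).IsElliptic := W.isElliptic_localMinimalModel v
  haveI : (W.localMinimalModel v).HasGoodReduction (v.adicCompletionIntegers K) := hgood
  obtain ⟨C, hC⟩ := W.exists_variableChange_smul_eq_localMinimalModel v
  obtain ⟨Φ, hΦ⟩ := W.exists_addEquiv_localPoints_of_smul_eq v hC
  have key := (W.localMinimalModel v).map_eq_of_forall_pow_eq_one_of_hasGoodReduction
    hp hpv hpP hP0 hPint hτ (Φ Q) (by rw [← map_nsmul, hQ, map_zero])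
  apply Φ.injective
  rw [hΦ]
  exact key

/-- **Global form: a decomposition group above `v ∣ p` acts on `E[p]` through its action on
`μ_p`.**  For an elliptic curve `E/K` over a number field with good reduction at `v ∣ p`, whose
minimal model at `v` has a `K_v`-rational point `P ≠ O` with `p P = O` and integral abscissa, a
prime `𝔓` of `\bar ℤ_K` above `v` and `τ` in the decomposition group `D_𝔓 ≤ Gal(K̄/K)` fixing the
`p`-th roots of unity of `K̄`: `τ` fixes every `Q ∈ E(K̄)` with `p Q = O`.  That is, the primes of
`K(ζ_p)` above `v` split completely in `K(E[p])/K(ζ_p)` — in particular they are unramified, Mazur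
1977, III.§5, Step 4 (ii) ("`L/K` is unramified at all places of `K` lying above `N`", `L = ℚ(E[N])`,
`K = ℚ(ζ_N)`).  From the local form by lifting `τ` to `Γ_{K_v}` along an embedding `K̄ → K̄_v`
cutting out `𝔓` (Neukirch II (9.6) for decomposition groups,
`exists_apply_eq_smul_of_mem_decompositionSubgroup`); the lift fixes `μ_p(K̄_v) = ι(μ_p(K̄))`.
[cite: Mazur1977, Ch. III §5, Step 4 (ii), p. 160] [cite: NeukirchANT1999, Ch. II §9 Prop. (9.6)] -/
theorem smul_eq_of_forall_pow_eq_one_of_hasGoodReductionAt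
    (W : WeierstrassCurve K) [W.IsElliptic] (hgood : W.HasGoodReductionAt v)
    {p : ℕ} (hp : p.Prime) (hpv : (p : 𝓞 K) ∈ v.asIdeal)
    {P : (W.localMinimalModel v).toAffine.Point} (hpP : p • P = 0) (hP0 : P ≠ 0)
    (hPint : ∀ {x y : v.adicCompletion K} (h : (W.localMinimalModel v).toAffine.Nonsingular x y),
      P = .some x y h → x ∈ v.adicCompletionIntegers K)
    {𝔓 : Ideal (absIntegers (𝓞 K) K)} (h𝔓 : 𝔓 ∈ v.primesAbove)
    {τ : absoluteGaloisGroup K} (hτD : τ ∈ 𝔓.decompositionSubgroup (absoluteGaloisGroup K))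
    (hτ : ∀ ζ : AlgebraicClosure K, ζ ^ p = 1 → τ • ζ = ζ)
    {Q : geomPoints W} (hQ : p • Q = 0) : τ • Q = Q := by
  haveI : Fact p.Prime := ⟨hp⟩
  haveI : CharZero (v.adicCompletion K) :=
    charZero_of_injective_algebraMap (algebraMap K (v.adicCompletion K)).injective
  have hpF : (p : v.adicCompletion K) ≠ 0 := Nat.cast_ne_zero.mpr hp.ne_zero
  have hpL : ((p : ℕ) : AlgebraicClosure (v.adicCompletion K)) ≠ 0 := fun h ↦ hpF
    ((algebraMap (v.adicCompletion K) (AlgebraicClosure (v.adicCompletion K))).injective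
      (by rw [map_natCast, map_zero, h]))
  haveI : NeZero ((p : ℕ) : AlgebraicClosure K) := ⟨by exact_mod_cast hp.ne_zero⟩
  obtain ⟨𝔐, h𝔐⟩ := v.localPrimesAbove_nonempty
  -- arrange `𝔓 = 𝔓_{ι,𝔐}` for an embedding `ι : K̄ → K̄_v`
  obtain ⟨g, hg⟩ := HeightOneSpectrum.exists_smul_eq_of_mem_primesAbove_holds
    (HeightOneSpectrum.primeBelow_mem_primesAbove
      (ι := closureEmb (K := K) (v.adicCompletion K)) h𝔐) h𝔓
  set ι : AlgebraicClosure K →ₐ[K] AlgebraicClosure (v.adicCompletion K) :=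
    (closureEmb (K := K) (v.adicCompletion K)).comp
      ((show AlgebraicClosure K ≃ₐ[K] AlgebraicClosure K from g⁻¹) :
        AlgebraicClosure K →ₐ[K] AlgebraicClosure K) with hι
  have h1 : 𝔓 = v.primeBelow ι 𝔐 := by
    rw [hι, HeightOneSpectrum.primeBelow_comp, ← hg]
    exact congrArg (· • _) (inv_inv g).symm
  rw [h1] at hτD
  -- lift `τ` to `Γ_{K_v}` (Neukirch II (9.6) for decomposition groups)
  obtain ⟨σ, hσ⟩ := exists_apply_eq_smul_of_mem_decompositionSubgroup ι h𝔐 hτD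
  have hres : resGalOfEmb ι σ = τ := resGalOfEmb_eq_of_apply_eq ι hσ
  -- the lift fixes the `p`-th roots of unity of `K̄_v`, all of which come from `K̄`
  have hσζ : ∀ ζ : AlgebraicClosure (v.adicCompletion K), ζ ^ p = 1 → σ • ζ = ζ := by
    obtain ⟨ζ₀, hζ₀⟩ := HasEnoughRootsOfUnity.exists_primitiveRoot (AlgebraicClosure K) p
    have hιζ₀ : IsPrimitiveRoot (ι ζ₀) p := hζ₀.map_of_injective ι.injective
    intro ζ hζ
    obtain ⟨i, -, rfl⟩ := hιζ₀.eq_pow_of_pow_eq_one hζ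
    rw [smul_pow', ← hσ ζ₀, hτ ζ₀ hζ₀.pow_eq_one]
  have hequiv : pointsMapOfEmb W ι (τ • Q) = σ • pointsMapOfEmb W ι Q := by
    rw [← hres]
    exact pointsMapOfEmb_smul W ι σ Q
  have hfix : σ • pointsMapOfEmb W ι Q = pointsMapOfEmb W ι Q :=
    W.smul_localPoints_eq_of_forall_pow_eq_one_of_hasGoodReductionAt hgood hp hpv hpP hP0 hPint
      hσζ _ (by rw [← map_nsmul, hQ, map_zero])
  exact pointsMapOfEmb_injective W ι (hequiv.trans hfix)

/-- **The same (multiplicative case) for an elliptic curve `E/K` and its local points `E(K̄_v)`** at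
a place `v ∣ p` (`p` odd) of multiplicative reduction whose minimal model has a `K_v`-rational point
`P` with `p P = O` off `E₀(K_v)`: every `τ ∈ Γ_{K_v}` fixing the `p`-th roots of unity fixes
`E(K̄_v)[p]` (transport of `map_eq_of_forall_pow_eq_one_of_not_mem_goodReductionSubgroup` along the
equivariant `E(K̄_v) ≃ X(K̄_v)`).  Mazur 1977, III.§5, Step 4 (iii) at `q = N`.
[cite: Mazur1977, Ch. III §5, Step 4 (iii), p. 160] -/
theorem smul_localPoints_eq_of_forall_pow_eq_one_of_not_mem_goodReductionSubgroup
    (W : WeierstrassCurve K) [W.IsElliptic] (hmult : W.HasMultiplicativeReductionAt v)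
    {p : ℕ} (hp : p.Prime) (hp2 : p ≠ 2) (hpv : (p : 𝓞 K) ∈ v.asIdeal)
    {P : (W.localMinimalModel v).toAffine.Point} (hpP : p • P = 0)
    (hP : P ∉ (W.localMinimalModel v).goodReductionSubgroup (v.adicCompletionIntegers K))
    {τ : absoluteGaloisGroup (v.adicCompletion K)}
    (hτ : ∀ ζ : AlgebraicClosure (v.adicCompletion K), ζ ^ p = 1 → τ • ζ = ζ)
    (Q : localPoints W (v.adicCompletion K)) (hQ : p • Q = 0) : τ • Q = Q := by
  haveI : (W.localMinimalModel v).IsElliptic := W.isElliptic_localMinimalModel v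
  haveI : (W.localMinimalModel v).HasMultiplicativeReduction (v.adicCompletionIntegers K) := hmult
  obtain ⟨C, hC⟩ := W.exists_variableChange_smul_eq_localMinimalModel v
  obtain ⟨Φ, hΦ⟩ := W.exists_addEquiv_localPoints_of_smul_eq v hC
  have key := (W.localMinimalModel v).map_eq_of_forall_pow_eq_one_of_not_mem_goodReductionSubgroup
    hp hp2 hpv hpP hP hτ (Φ Q) (by rw [← map_nsmul, hQ, map_zero])
  apply Φ.injective
  rw [hΦ]
  exact key

/-- **Global form (multiplicative case): a decomposition group above `v ∣ p` acts on `E[p]` through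
its action on `μ_p`.**  For an elliptic curve `E/K` over a number field with multiplicative
reduction at `v ∣ p` (`p` odd), whose minimal model at `v` has a `K_v`-rational point `P` with
`p P = O` off `E₀(K_v)`, a prime `𝔓` of `\bar ℤ_K` above `v` and `τ ∈ D_𝔓 ≤ Gal(K̄/K)` fixing the
`p`-th roots of unity of `K̄`: `τ` fixes every `Q ∈ E(K̄)` with `p Q = O` — the primes of `K(ζ_p)`
above `v` split completely in `K(E[p])/K(ζ_p)`, in particular are unramified (Mazur 1977, III.§5,
Step 4 (iii) at `q = N`).  Glue as in `smul_eq_of_forall_pow_eq_one_of_hasGoodReductionAt`.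
[cite: Mazur1977, Ch. III §5, Step 4 (iii), p. 160] [cite: NeukirchANT1999, Ch. II §9 Prop. (9.6)] -/
theorem smul_eq_of_forall_pow_eq_one_of_not_mem_goodReductionSubgroup
    (W : WeierstrassCurve K) [W.IsElliptic] (hmult : W.HasMultiplicativeReductionAt v)
    {p : ℕ} (hp : p.Prime) (hp2 : p ≠ 2) (hpv : (p : 𝓞 K) ∈ v.asIdeal)
    {P : (W.localMinimalModel v).toAffine.Point} (hpP : p • P = 0)
    (hP : P ∉ (W.localMinimalModel v).goodReductionSubgroup (v.adicCompletionIntegers K))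
    {𝔓 : Ideal (absIntegers (𝓞 K) K)} (h𝔓 : 𝔓 ∈ v.primesAbove)
    {τ : absoluteGaloisGroup K} (hτD : τ ∈ 𝔓.decompositionSubgroup (absoluteGaloisGroup K))
    (hτ : ∀ ζ : AlgebraicClosure K, ζ ^ p = 1 → τ • ζ = ζ)
    {Q : geomPoints W} (hQ : p • Q = 0) : τ • Q = Q := by
  haveI : Fact p.Prime := ⟨hp⟩
  haveI : NeZero ((p : ℕ) : AlgebraicClosure K) := ⟨by exact_mod_cast hp.ne_zero⟩
  obtain ⟨𝔐, h𝔐⟩ := v.localPrimesAbove_nonempty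
  obtain ⟨g, hg⟩ := HeightOneSpectrum.exists_smul_eq_of_mem_primesAbove_holds
    (HeightOneSpectrum.primeBelow_mem_primesAbove
      (ι := closureEmb (K := K) (v.adicCompletion K)) h𝔐) h𝔓
  set ι : AlgebraicClosure K →ₐ[K] AlgebraicClosure (v.adicCompletion K) :=
    (closureEmb (K := K) (v.adicCompletion K)).comp
      ((show AlgebraicClosure K ≃ₐ[K] AlgebraicClosure K from g⁻¹) :
        AlgebraicClosure K →ₐ[K] AlgebraicClosure K) with hι
  have h1 : 𝔓 = v.primeBelow ι 𝔐 := by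
    rw [hι, HeightOneSpectrum.primeBelow_comp, ← hg]
    exact congrArg (· • _) (inv_inv g).symm
  rw [h1] at hτD
  obtain ⟨σ, hσ⟩ := exists_apply_eq_smul_of_mem_decompositionSubgroup ι h𝔐 hτD
  have hres : resGalOfEmb ι σ = τ := resGalOfEmb_eq_of_apply_eq ι hσ
  have hσζ : ∀ ζ : AlgebraicClosure (v.adicCompletion K), ζ ^ p = 1 → σ • ζ = ζ := by
    obtain ⟨ζ₀, hζ₀⟩ := HasEnoughRootsOfUnity.exists_primitiveRoot (AlgebraicClosure K) p
    have hιζ₀ : IsPrimitiveRoot (ι ζ₀) p := hζ₀.map_of_injective ι.injective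
    intro ζ hζ
    obtain ⟨i, -, rfl⟩ := hιζ₀.eq_pow_of_pow_eq_one hζ
    rw [smul_pow', ← hσ ζ₀, hτ ζ₀ hζ₀.pow_eq_one]
  have hequiv : pointsMapOfEmb W ι (τ • Q) = σ • pointsMapOfEmb W ι Q := by
    rw [← hres]
    exact pointsMapOfEmb_smul W ι σ Q
  have hfix : σ • pointsMapOfEmb W ι Q = pointsMapOfEmb W ι Q :=
    W.smul_localPoints_eq_of_forall_pow_eq_one_of_not_mem_goodReductionSubgroup hmult hp hp2 hpv
      hpP hP hσζ _ (by rw [← map_nsmul, hQ, map_zero])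
  exact pointsMapOfEmb_injective W ι (hequiv.trans hfix)

/-- **At a multiplicative place `v ∣ p`, an integral `K_v`-rational `p`-torsion point `≠ O` lies off
`E₀(K_v)`** (Mazur 1977, p. 159, "`(E_{/𝔽_q})⁰` is isomorphic to `𝔾_m`", at `q = N`): on the
minimal model, `E₀(K_v)/E₁(K_v)` embeds in `\bar κ_v^×` (Silverman, *AEC* VII.2.1 with III.2.5;
tree `exists_addMonoidHom_units_of_node`), which has no element of order `p = char κ_v`
(`x^p = 1 ⇒ x = 1`), and an integral point does not lie in `E₁(K_v)`.  The tree's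
`not_mem_goodReductionSubgroup_of_hasMultiplicativeReduction` (`MazurTorsionStepTwoAtNProofs`,
over `ℤ_[p]`) in the language of the completions `v.adicCompletion K`, the integrality of the point
being taken as a hypothesis (over `ℚ` it is `mem_adicCompletionIntegers_of_prime_nsmul_eq_zero`).
[cite: Mazur1977, Ch. III §5, Step 2, p. 159; SilvermanAEC2009, VII.2 Prop. 2.1, III.2.5] -/
theorem not_mem_goodReductionSubgroup_of_hasMultiplicativeReduction_of_mem_adicCompletionIntegers
    (X : WeierstrassCurve (v.adicCompletion K)) [X.IsElliptic]
    [hmult : X.HasMultiplicativeReduction (v.adicCompletionIntegers K)]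
    {p : ℕ} (hp : p.Prime) (hpv : (p : 𝓞 K) ∈ v.asIdeal)
    {P : X.toAffine.Point} (hpP : p • P = 0) (hP0 : P ≠ 0)
    (hPint : ∀ {x y : v.adicCompletion K} (h : X.toAffine.Nonsingular x y),
      P = .some x y h → x ∈ v.adicCompletionIntegers K) :
    P ∉ X.goodReductionSubgroup (v.adicCompletionIntegers K) := by
  haveI : Fact p.Prime := ⟨hp⟩
  obtain ⟨X₀, rfl⟩ : ∃ X₀ : WeierstrassCurve (v.adicCompletionIntegers K),
      X = X₀.baseChange (v.adicCompletion K) := IsIntegral.integral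
  have hvR := integers_valuationRing_valuation (v.adicCompletionIntegers K) (v.adicCompletion K)
  rw [goodReductionSubgroup_baseChange_eq, mem_nonsingularReductionSubgroup_iff]
  intro hE₀
  -- the reduction of `X₀` is a node
  have eΔ : (X₀.baseChange (v.adicCompletion K)).Δ =
      algebraMap (v.adicCompletionIntegers K) (v.adicCompletion K) X₀.Δ := map_Δ X₀ _
  have ec : (X₀.baseChange (v.adicCompletion K)).c₄ =
      algebraMap (v.adicCompletionIntegers K) (v.adicCompletion K) X₀.c₄ := map_c₄ X₀ _
  have hΔm := hmult.badReduction
  have hc₄u := hmult.multiplicativeReduction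
  rw [eΔ, IsDedekindDomain.HeightOneSpectrum.valuation_lt_one_iff_mem] at hΔm
  rw [ec, IsDedekindDomain.HeightOneSpectrum.valuation_eq_one_iff_notMem] at hc₄u
  have hΔ' : IsLocalRing.residue (v.adicCompletionIntegers K) X₀.Δ = 0 :=
    (IsLocalRing.residue_eq_zero_iff _).mpr hΔm
  have hc₄' : IsLocalRing.residue (v.adicCompletionIntegers K) X₀.c₄ ≠ 0 :=
    fun h ↦ hc₄u ((IsLocalRing.residue_eq_zero_iff _).mp h)
  obtain ⟨r, hr⟩ := X₀.exists_addMonoidHom_units_of_node hvR hΔ' hc₄'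
  -- `\bar κ_v` has characteristic `p`
  have hp0 : (p : IsLocalRing.ResidueField (v.adicCompletionIntegers K)) = 0 := by
    have h := (HeightOneSpectrum.residue_algebraMap_eq_zero_iff K v (p : 𝓞 K)).mpr hpv
    simpa only [map_natCast] using h
  haveI : CharP (AlgebraicClosure (IsLocalRing.ResidueField (v.adicCompletionIntegers K))) p := by
    refine (CharP.charP_iff_prime_eq_zero hp).mpr ?_
    rw [← map_natCast (algebraMap (IsLocalRing.ResidueField (v.adicCompletionIntegers K))
      (AlgebraicClosure (IsLocalRing.ResidueField (v.adicCompletionIntegers K)))) p, hp0, map_zero]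
  -- the image of `P` in `\bar κ_v^×` is killed by `p`, hence trivial
  set u := r ⟨P, hE₀⟩ with hu
  have hpu : p • u = 0 := by
    rw [hu, ← map_nsmul]
    have : p • (⟨P, hE₀⟩ : X₀.nonsingularReductionSubgroup hvR) = 0 := Subtype.ext (by
      simp only [AddSubgroup.coe_nsmul, ZeroMemClass.coe_zero]
      exact hpP)
    rw [this, map_zero]
  have hu1 : Additive.toMul u = 1 := by
    set z : (AlgebraicClosure (IsLocalRing.ResidueField (v.adicCompletionIntegers K)))ˣ :=
      Additive.toMul u with hz
    have h1 : z ^ p = 1 := by rw [hz, ← toMul_nsmul, hpu, toMul_zero]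
    have h1' : (z : AlgebraicClosure (IsLocalRing.ResidueField (v.adicCompletionIntegers K))) ^ p = 1 := by
      rw [← Units.val_pow_eq_pow_val, h1, Units.val_one]
    have h2 : ((z : AlgebraicClosure (IsLocalRing.ResidueField (v.adicCompletionIntegers K))) - 1) ^ p
        = 0 := by
      rw [sub_pow_char, h1', one_pow, sub_self]
    exact Units.ext (sub_eq_zero.mp ((pow_eq_zero_iff hp.ne_zero).mp h2))
  have hu0 : u = 0 := by
    rw [← ofMul_toMul u, hu1, ofMul_one]
  have hred : X₀.ReducesToZero P := (hr ⟨P, hE₀⟩).mp hu0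
  -- but an integral point does not reduce to `O`
  rcases hPc : P with _ | ⟨x, y, h⟩
  · exact hP0 hPc
  · rw [hPc, reducesToZero_some_iff] at hred
    exact hred ⟨⟨x, hPint h hPc⟩, rfl⟩

end WeierstrassCurve

namespace Literature.NumberTheory.EllipticCurves

open _root_.WeierstrassCurve IsDedekindDomain IsDedekindDomain.HeightOneSpectrum NumberField Field
  Literature.NumberTheory.GaloisRepresentations Rat.HeightOneSpectrum

/-! ## Over `ℚ`: the abscissa of a rational `N`-torsion point is `N`-integral; Step 4 (ii) at `N` -/

section Rat

variable (W : WeierstrassCurve ℚ) [W.IsElliptic]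

omit [W.IsElliptic] in
/-- **`E₁(ℚ_v)[p] = 0` for the place `v` of `ℚ` above an odd prime `p`**, for the completion
`ℚ_v = v.adicCompletion ℚ`: on a `v`-integral Weierstrass equation `X` of an elliptic curve over
`ℚ_v`, a point `(x, y)` killed by `p = p_v ≥ 3` has `v`-integral abscissa (Silverman, *AEC*,
VII.3.1 with IV.6.1 for `ℚ_p`, `e = 1 < p - 1`).  Transport of the tree's
`not_prime_zsmul_eq_zero_of_one_lt_norm` (`MazurTorsionStepOneAtNProofs`, over `ℚ_[p]` by division
polynomials) along Mathlib's `padicEquiv v : ℚ_v ≃ₐ[ℚ] ℚ_[p]`, `padicIntEquiv v : 𝓞_v ≃ ℤ_[p]`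
(`mapPoint`, `baseChange_map_ringEquiv`, `ringEquiv_mem_range_algebraMap_iff`).
[cite: SilvermanAEC2009, VII.3 Prop. 3.1 and IV.6 Thm. 6.1] -/
theorem mem_adicCompletionIntegers_of_prime_nsmul_eq_zero (v : HeightOneSpectrum (𝓞 ℚ))
    (hp3 : 3 ≤ (primesEquiv v : ℕ)) (X : WeierstrassCurve (v.adicCompletion ℚ)) [X.IsElliptic]
    [X.IsIntegral (v.adicCompletionIntegers ℚ)] {x y : v.adicCompletion ℚ}
    (h : X.toAffine.Nonsingular x y)
    (hP : (primesEquiv v : ℕ) • (Affine.Point.some x y h : X.toAffine.Point) = 0) :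
    x ∈ v.adicCompletionIntegers ℚ := by
  haveI := Fact.mk (primesEquiv v).2
  obtain ⟨X₀, rfl⟩ : ∃ X₀ : WeierstrassCurve (v.adicCompletionIntegers ℚ),
      X = X₀.baseChange (v.adicCompletion ℚ) := IsIntegral.integral
  set ψ := (adicCompletionIntegers.padicIntEquiv v).toRingEquiv with hψ
  set φ := (adicCompletion.padicEquiv v).toRingEquiv with hφ
  have hc : ∀ r : v.adicCompletionIntegers ℚ,
      φ (algebraMap _ (v.adicCompletion ℚ) r) =
        algebraMap ℤ_[(primesEquiv v : ℕ)] ℚ_[(primesEquiv v : ℕ)] (ψ r) := fun r ↦ rfl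
  have he : (X₀.baseChange (v.adicCompletion ℚ)).map (φ : v.adicCompletion ℚ →+* ℚ_[(primesEquiv v : ℕ)]) =
      (X₀.map (ψ : v.adicCompletionIntegers ℚ →+* ℤ_[(primesEquiv v : ℕ)])).baseChange
        ℚ_[(primesEquiv v : ℕ)] := baseChange_map_ringEquiv ψ φ hc X₀
  haveI : ((X₀.map (ψ : v.adicCompletionIntegers ℚ →+* ℤ_[(primesEquiv v : ℕ)])).baseChange
      ℚ_[(primesEquiv v : ℕ)]).IsElliptic := by
    rw [← he]; infer_instance
  by_contra hx
  -- the transported point `(φ x, φ y)` is killed by `p` and has `‖φ x‖ > 1`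
  set Q := mapPoint (φ : v.adicCompletion ℚ →+* ℚ_[(primesEquiv v : ℕ)]) he
    (Affine.Point.some x y h) with hQ
  have hkill : ((primesEquiv v : ℕ) : ℤ) • Q = 0 := by
    rw [hQ, natCast_zsmul, ← map_nsmul, hP, map_zero]
  have hx' : (φ : v.adicCompletion ℚ →+* ℚ_[(primesEquiv v : ℕ)]) x ∉
      Set.range (algebraMap ℤ_[(primesEquiv v : ℕ)] ℚ_[(primesEquiv v : ℕ)]) := by
    intro hmem
    apply hx
    have hmem' : (φ : v.adicCompletion ℚ →+* ℚ_[(primesEquiv v : ℕ)]) x ∈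
        (algebraMap ℤ_[(primesEquiv v : ℕ)] ℚ_[(primesEquiv v : ℕ)]).range := by
      rwa [RingHom.mem_range, ← Set.mem_range]
    have := (ringEquiv_mem_range_algebraMap_iff ψ φ hc x).mp hmem'
    obtain ⟨a, ha⟩ := RingHom.mem_range.mp this
    rw [← ha]
    exact a.2
  have hx1 : 1 < ‖(φ : v.adicCompletion ℚ →+* ℚ_[(primesEquiv v : ℕ)]) x‖ := by
    by_contra hle
    push Not at hle
    exact hx' ⟨⟨_, hle⟩, rfl⟩
  rw [hQ, mapPoint_some] at hkill
  exact not_prime_zsmul_eq_zero_of_one_lt_norm hp3 _ _ hx1 hkill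

omit [W.IsElliptic] in
/-- A rational prime `q` lies in the place `v` of `ℚ` above it (`primesEquiv v = q`). [folklore] -/
private theorem natCast_primesEquiv_mem_asIdeal (v : HeightOneSpectrum (𝓞 ℚ)) :
    ((primesEquiv v : ℕ) : 𝓞 ℚ) ∈ v.asIdeal := by
  change ((natGenerator v : ℕ) : 𝓞 ℚ) ∈ v.asIdeal
  have h := (natGenerator_dvd_iff v (n := natGenerator v)).mp dvd_rfl
  rw [Ideal.mem_map_of_equiv] at h
  obtain ⟨x, hx, hxn⟩ := h
  have : x = natGenerator v :=
    (Rat.IsIntegralClosure.intEquiv (𝓞 ℚ)).injective (by rw [hxn, map_natCast])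
  rwa [this] at hx

/-- **Mazur 1977, III.§5, Step 4 (ii) over `ℚ`, for a point of order `N` of the minimal model at
the place above `N`.**  Let `E/ℚ` be an elliptic curve with good reduction at the place `v` above a
prime `N ≥ 3`, `P'` a `ℚ_v`-rational point of order `N` of `E.localMinimalModel v`, `𝔓` a prime of
`\\bar ℤ` above `v` and `τ ∈ D_𝔓 ≤ Gal(ℚ̄/ℚ)` fixing the `N`-th roots of unity.  Then `τ` fixes every
`Q ∈ E(ℚ̄)` with `N Q = O` (`smul_eq_of_forall_pow_eq_one_of_hasGoodReductionAt`, the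
`N`-integrality of `P'` being `mem_adicCompletionIntegers_of_prime_nsmul_eq_zero`).
[cite: Mazur1977, Ch. III §5, Step 4 (ii), p. 160] -/
theorem Mazur1977_smul_eq_of_forall_pow_eq_one_of_addOrderOf_eq {N : ℕ} (hN : N.Prime)
    (hN3 : 3 ≤ N) (v : HeightOneSpectrum (𝓞 ℚ)) (hv : (primesEquiv v : ℕ) = N)
    (hgood : W.HasGoodReductionAt v) {P' : (W.localMinimalModel v).toAffine.Point}
    (hord : addOrderOf P' = N)
    {𝔓 : Ideal (absIntegers (𝓞 ℚ) ℚ)} (h𝔓 : 𝔓 ∈ v.primesAbove)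
    {τ : absoluteGaloisGroup ℚ} (hτD : τ ∈ 𝔓.decompositionSubgroup (absoluteGaloisGroup ℚ))
    (hτ : ∀ ζ : AlgebraicClosure ℚ, ζ ^ N = 1 → τ • ζ = ζ)
    {Q : geomPoints W} (hQ : N • Q = 0) : τ • Q = Q := by
  haveI : (W.localMinimalModel v).IsElliptic := W.isElliptic_localMinimalModel v
  have hNv : (N : 𝓞 ℚ) ∈ v.asIdeal := hv ▸ natCast_primesEquiv_mem_asIdeal v
  have hP'0 : P' ≠ 0 := by
    intro h0
    rw [h0, addOrderOf_zero] at hord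
    exact absurd hord.symm (by omega)
  have hkill : N • P' = 0 := by
    have e := addOrderOf_nsmul_eq_zero P'
    rwa [hord] at e
  have hPint : ∀ {x y : v.adicCompletion ℚ} (h : (W.localMinimalModel v).toAffine.Nonsingular x y),
      P' = .some x y h → x ∈ v.adicCompletionIntegers ℚ := by
    intro x y h hxy
    refine mem_adicCompletionIntegers_of_prime_nsmul_eq_zero v (by omega) (W.localMinimalModel v) h ?_
    rw [hv, ← hxy]
    exact hkill
  exact W.smul_eq_of_forall_pow_eq_one_of_hasGoodReductionAt hgood hN hNv hkill hP'0 hPint h𝔓 hτD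
    hτ hQ

/-- **Mazur 1977, III.§5, Step 4 (ii) over `ℚ`: at the prime `N` itself, with good reduction,
`E[N] ≅ ℤ/N ⊕ μ_N` locally.**  Let `E/ℚ` have a rational point `P` of prime order
`N ∉ {2, 3, 5, 7, 13}` and good reduction at the place `v` above `N`, let `𝔓` be a prime of `\\bar ℤ`
above `v` and `τ ∈ D_𝔓 ≤ Gal(ℚ̄/ℚ)` an element of the decomposition group fixing the `N`-th roots
of unity.  Then `τ` fixes every `Q ∈ E(ℚ̄)` with `N Q = O`: the primes of `K = ℚ(ζ_N)` above `N`
split completely (in particular are unramified) in `L = K(E[N])` — the printed "(ii) `q = N`; `E`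
has good reduction at `N`: … `E[N]_{/ℤ_N} = ℤ/N × μ_N`, which shows that `L/K` is unramified at all
places of `K` lying above `N`".  (By `Mazur1977_at_N` the reduction at `N` is good — and then
anomalous — or split multiplicative; the multiplicative case of Step 4 at `N`, printed under (iii),
is not treated in this file.)
[cite: Mazur1977, Ch. III §5, Step 4 (ii), p. 160] -/
theorem Mazur1977_smul_eq_of_forall_pow_eq_one_of_hasGoodReductionAt {N : ℕ} (hN : N.Prime)
    (hNS : N ∉ ({2, 3, 5, 7, 13} : Finset ℕ)) {P : W.toAffine.Point} (hP : addOrderOf P = N)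
    (v : HeightOneSpectrum (𝓞 ℚ)) (hv : (primesEquiv v : ℕ) = N) (hgood : W.HasGoodReductionAt v)
    {𝔓 : Ideal (absIntegers (𝓞 ℚ) ℚ)} (h𝔓 : 𝔓 ∈ v.primesAbove)
    {τ : absoluteGaloisGroup ℚ} (hτD : τ ∈ 𝔓.decompositionSubgroup (absoluteGaloisGroup ℚ))
    (hτ : ∀ ζ : AlgebraicClosure ℚ, ζ ^ N = 1 → τ • ζ = ζ)
    {Q : geomPoints W} (hQ : N • Q = 0) : τ • Q = Q := by
  have h11 := eleven_le_of_prime_of_not_mem hN hNS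
  have hord : addOrderOf (VariableChange.pointEquiv (W.baseChange (v.adicCompletion ℚ))
      ((W.baseChange (v.adicCompletion ℚ)).exists_isMinimal (v.adicCompletionIntegers ℚ)).choose
      (Affine.Point.map (W' := W.toAffine) (S := ℚ) (Algebra.ofId ℚ (v.adicCompletion ℚ)) P)) = N :=
    ((AddEquiv.addOrderOf_eq _ _).trans (addOrderOf_injective _
      (Affine.Point.map_injective (W' := W.toAffine) (f := Algebra.ofId ℚ (v.adicCompletion ℚ))) P)).trans hP
  exact Mazur1977_smul_eq_of_forall_pow_eq_one_of_addOrderOf_eq W hN (by omega) v hv hgood hord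
    h𝔓 hτD hτ hQ


/-- **Mazur 1977, III.§5, Step 4 at the prime `N` itself, for a point of order `N` of the minimal
model at the place above `N`.**  Let `E/ℚ` have a rational point `P` of prime order
`N ∉ {2, 3, 5, 7, 13}`, let `v` be the place above `N`, `P'` any `ℚ_v`-point of order `N` of
`E.localMinimalModel v`, `𝔓` a prime of `\\bar ℤ` above `v` and `τ ∈ D_𝔓` fixing the `N`-th roots of
unity.  Then `τ` fixes every `Q ∈ E(ℚ̄)` with `N Q = O`.  By `Mazur1977_at_N` the reduction at `N`
is good (case (ii), `Mazur1977_smul_eq_of_forall_pow_eq_one_of_addOrderOf_eq`) or split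
multiplicative, when `P'` is off `E₀(ℚ_v)`
(`not_mem_goodReductionSubgroup_of_hasMultiplicativeReduction_of_mem_adicCompletionIntegers`, its
`N`-integrality being `mem_adicCompletionIntegers_of_prime_nsmul_eq_zero`) and case (iii) at `N`
applies (`smul_eq_of_forall_pow_eq_one_of_not_mem_goodReductionSubgroup`); the bridges
`ℚ_[N] ↔ ℚ_v` are the tree's `hasGoodReductionAtPrime_primesEquiv_iff_holds` and
`hasMultiplicativeReductionAtPrime_primesEquiv_iff_holds`.
[cite: Mazur1977, Ch. III §5, Step 4 (ii)–(iii), p. 160] -/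
theorem Mazur1977_smul_eq_of_forall_pow_eq_one_at_N_of_addOrderOf_eq {N : ℕ} [Fact N.Prime]
    (hNS : N ∉ ({2, 3, 5, 7, 13} : Finset ℕ)) {P : W.toAffine.Point} (hP : addOrderOf P = N)
    (v : HeightOneSpectrum (𝓞 ℚ)) (hv : (primesEquiv v : ℕ) = N)
    {P' : (W.localMinimalModel v).toAffine.Point} (hord : addOrderOf P' = N)
    {𝔓 : Ideal (absIntegers (𝓞 ℚ) ℚ)} (h𝔓 : 𝔓 ∈ v.primesAbove)
    {τ : absoluteGaloisGroup ℚ} (hτD : τ ∈ 𝔓.decompositionSubgroup (absoluteGaloisGroup ℚ))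
    (hτ : ∀ ζ : AlgebraicClosure ℚ, ζ ^ N = 1 → τ • ζ = ζ)
    {Q : geomPoints W} (hQ : N • Q = 0) : τ • Q = Q := by
  have hN : N.Prime := Fact.out
  have h11 := eleven_le_of_prime_of_not_mem hN hNS
  haveI : (W.localMinimalModel v).IsElliptic := W.isElliptic_localMinimalModel v
  have hNv : (N : 𝓞 ℚ) ∈ v.asIdeal := hv ▸ natCast_primesEquiv_mem_asIdeal v
  rcases Mazur1977_at_N W N hNS hP with ⟨hgoodp, -⟩ | ⟨hsplitp, -⟩
  · have hgood : W.HasGoodReductionAt v :=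
      (hasGoodReductionAtPrime_primesEquiv_iff_holds W v N hv).mp hgoodp
    exact Mazur1977_smul_eq_of_forall_pow_eq_one_of_addOrderOf_eq W hN (by omega) v hv hgood hord
      h𝔓 hτD hτ hQ
  · have hmult : W.HasMultiplicativeReductionAt v :=
      (hasMultiplicativeReductionAtPrime_primesEquiv_iff_holds W v N hv).mp
        hsplitp.hasMultiplicativeReductionAtPrime
    haveI : (W.localMinimalModel v).HasMultiplicativeReduction (v.adicCompletionIntegers ℚ) := hmult
    have hkill : N • P' = 0 := by
      have e := addOrderOf_nsmul_eq_zero P'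
      rwa [hord] at e
    have hP'0 : P' ≠ 0 := by
      intro h0
      rw [h0, addOrderOf_zero] at hord
      exact absurd hord.symm (by omega)
    have hPint : ∀ {x y : v.adicCompletion ℚ} (h : (W.localMinimalModel v).toAffine.Nonsingular x y),
        P' = .some x y h → x ∈ v.adicCompletionIntegers ℚ := by
      intro x y h hxy
      refine mem_adicCompletionIntegers_of_prime_nsmul_eq_zero v (by omega) (W.localMinimalModel v) h ?_
      rw [hv, ← hxy]
      exact hkill
    have hnot := (W.localMinimalModel v).not_mem_goodReductionSubgroup_of_hasMultiplicativeReduction_of_mem_adicCompletionIntegers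
      hN hNv hkill hP'0 hPint
    exact W.smul_eq_of_forall_pow_eq_one_of_not_mem_goodReductionSubgroup hmult hN (by omega) hNv
      hkill hnot h𝔓 hτD hτ hQ

/-- **Mazur 1977, III.§5, Step 4 at the prime `N` itself: a decomposition group above `N` acts on
`E[N]` through its action on `μ_N`.**  Let `E/ℚ` have a rational point `P` of prime order
`N ∉ {2, 3, 5, 7, 13}`, let `v` be the place of `ℚ` above `N`, `𝔓` a prime of `\\bar ℤ` above `v`
and `τ ∈ D_𝔓 ≤ Gal(ℚ̄/ℚ)` fixing the `N`-th roots of unity.  Then `τ` fixes every `Q ∈ E(ℚ̄)` with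
`N Q = O`: the primes of `K = ℚ(ζ_N)` above `N` split completely — in particular are unramified — in
`L = K(E[N])`, the conclusion of Step 4 at `q = N` ("(ii) `q = N`; `E` has good reduction at `N` …
(iii) `q` a rational prime of bad reduction for `E` … giving us the same conclusion: that all places
of `K` above `q` are unramified in `L/K`").  From
`Mazur1977_smul_eq_of_forall_pow_eq_one_at_N_of_addOrderOf_eq` for the image of `P` on the minimal
model.
[cite: Mazur1977, Ch. III §5, Step 4 (ii)–(iii), p. 160] -/
theorem Mazur1977_smul_eq_of_forall_pow_eq_one_at_N {N : ℕ} [Fact N.Prime]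
    (hNS : N ∉ ({2, 3, 5, 7, 13} : Finset ℕ)) {P : W.toAffine.Point} (hP : addOrderOf P = N)
    (v : HeightOneSpectrum (𝓞 ℚ)) (hv : (primesEquiv v : ℕ) = N)
    {𝔓 : Ideal (absIntegers (𝓞 ℚ) ℚ)} (h𝔓 : 𝔓 ∈ v.primesAbove)
    {τ : absoluteGaloisGroup ℚ} (hτD : τ ∈ 𝔓.decompositionSubgroup (absoluteGaloisGroup ℚ))
    (hτ : ∀ ζ : AlgebraicClosure ℚ, ζ ^ N = 1 → τ • ζ = ζ)
    {Q : geomPoints W} (hQ : N • Q = 0) : τ • Q = Q := by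
  have hord : addOrderOf (VariableChange.pointEquiv (W.baseChange (v.adicCompletion ℚ))
      ((W.baseChange (v.adicCompletion ℚ)).exists_isMinimal (v.adicCompletionIntegers ℚ)).choose
      (Affine.Point.map (W' := W.toAffine) (S := ℚ) (Algebra.ofId ℚ (v.adicCompletion ℚ)) P)) = N :=
    ((AddEquiv.addOrderOf_eq _ _).trans (addOrderOf_injective _
      (Affine.Point.map_injective (W' := W.toAffine) (f := Algebra.ofId ℚ (v.adicCompletion ℚ))) P)).trans hP
  exact Mazur1977_smul_eq_of_forall_pow_eq_one_at_N_of_addOrderOf_eq W hNS hP v hv hord h𝔓 hτD hτ hQ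


/-- **Mazur 1977, III.§5, Step 4 — "`L/K` is unramified" — at every finite place, from the
conclusion of Step 3.**  Let `E/ℚ` have a rational point `P` of prime order `N ∉ {2, 3, 5, 7, 13}`
and suppose, as Step 3 asserts at every bad prime, that the image of `P` on the minimal model lies
off `E₀(ℚ_v)` at every place `v` of bad reduction with `p_v ≠ N` (proved in the tree for
`p_v + 1 < N`, `Mazur1977_not_mem_goodReductionSubgroup_at`; at `p_v = N` it is automatic).  Then for
every finite place `v` of `ℚ`, every prime `𝔓` of `\\bar ℤ` above `v` and every `τ` in the inertia
group `I_𝔓 ≤ Gal(ℚ̄/ℚ)` fixing the `N`-th roots of unity — i.e. every element of an inertia group of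
`Gal(ℚ̄/K)`, `K = ℚ(ζ_N)` — `τ` fixes `E[N] = E(ℚ̄)[N]` pointwise: `L = K(E[N])` is unramified over
`K` at all finite places ("Step 4. — `L/K` is unramified.").  At `v ∤ N` this is
`Mazur1977_smul_eq_of_mem_inertia_of_stepThree` ((i) and (iii), where even `I_𝔓 ≤ Γ_ℚ` acts
trivially); at `v ∣ N` it is `Mazur1977_smul_eq_of_forall_pow_eq_one_at_N` ((ii) and (iii) at `N`,
for the whole decomposition group).
[cite: Mazur1977, Ch. III §5, Step 4, p. 160] -/
theorem Mazur1977_stepFour_of_stepThree {N : ℕ} [Fact N.Prime]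
    (hNS : N ∉ ({2, 3, 5, 7, 13} : Finset ℕ)) {P : W.toAffine.Point} (hP : addOrderOf P = N)
    (h3 : ∀ v : HeightOneSpectrum (𝓞 ℚ), ¬ W.HasGoodReductionAt v → (primesEquiv v : ℕ) ≠ N →
      VariableChange.pointEquiv (W.baseChange (v.adicCompletion ℚ))
          ((W.baseChange (v.adicCompletion ℚ)).exists_isMinimal (v.adicCompletionIntegers ℚ)).choose
          (Affine.Point.map (W' := W.toAffine) (S := ℚ) (Algebra.ofId ℚ (v.adicCompletion ℚ)) P) ∉
        (W.localMinimalModel v).goodReductionSubgroup (v.adicCompletionIntegers ℚ))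
    (v : HeightOneSpectrum (𝓞 ℚ)) {𝔓 : Ideal (absIntegers (𝓞 ℚ) ℚ)} (h𝔓 : 𝔓 ∈ v.primesAbove)
    {τ : absoluteGaloisGroup ℚ} (hτI : τ ∈ 𝔓.inertia (absoluteGaloisGroup ℚ))
    (hτ : ∀ ζ : AlgebraicClosure ℚ, ζ ^ N = 1 → τ • ζ = ζ)
    {Q : geomPoints W} (hQ : N • Q = 0) : τ • Q = Q := by
  have hN : N.Prime := Fact.out
  by_cases hv : (primesEquiv v : ℕ) = N
  · exact Mazur1977_smul_eq_of_forall_pow_eq_one_at_N W hNS hP v hv h𝔓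
      (Ideal.inertia_le_decompositionSubgroup _ _ hτI) hτ hQ
  · exact Mazur1977_smul_eq_of_mem_inertia_of_stepThree W hN hNS hP h3 v hv h𝔓 hτI hQ

/-- **Step 4 at the places above the primes `q` with `q + 1 < N` or `q = N`, unconditionally**:
for `E/ℚ` with a rational point of prime order `N ∉ {2, 3, 5, 7, 13}`, a place `v` with
`p_v + 1 < N` or `p_v = N`, `𝔓 ∣ v` and `τ ∈ I_𝔓` fixing the `N`-th roots of unity, `τ` fixes `E[N]`
pointwise (`Mazur1977_smul_eq_of_mem_inertia` at `p_v + 1 < N`,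
`Mazur1977_smul_eq_of_forall_pow_eq_one_at_N` at `p_v = N`).  The places left out are exactly those
above the bad primes `q ≥ N - 1`, `q ≠ N`, where the printed Step 3 uses the Eisenstein quotient.
[cite: Mazur1977, Ch. III §5, Step 4, p. 160] -/
theorem Mazur1977_stepFour_of_lt_or_eq {N : ℕ} [Fact N.Prime]
    (hNS : N ∉ ({2, 3, 5, 7, 13} : Finset ℕ)) {P : W.toAffine.Point} (hP : addOrderOf P = N)
    (v : HeightOneSpectrum (𝓞 ℚ)) (hv : (primesEquiv v : ℕ) + 1 < N ∨ (primesEquiv v : ℕ) = N)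
    {𝔓 : Ideal (absIntegers (𝓞 ℚ) ℚ)} (h𝔓 : 𝔓 ∈ v.primesAbove)
    {τ : absoluteGaloisGroup ℚ} (hτI : τ ∈ 𝔓.inertia (absoluteGaloisGroup ℚ))
    (hτ : ∀ ζ : AlgebraicClosure ℚ, ζ ^ N = 1 → τ • ζ = ζ)
    {Q : geomPoints W} (hQ : N • Q = 0) : τ • Q = Q := by
  have hN : N.Prime := Fact.out
  rcases hv with hlt | heq
  · exact Mazur1977_smul_eq_of_mem_inertia W hN hNS hP v hlt h𝔓 hτI hQ
  · exact Mazur1977_smul_eq_of_forall_pow_eq_one_at_N W hNS hP v heq h𝔓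
      (Ideal.inertia_le_decompositionSubgroup _ _ hτI) hτ hQ

end Rat

end Literature.NumberTheory.EllipticCurves

end
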